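import Literature.NumberTheory.Rogawski1990.RankOneUnstableRamifiedDepthExpansionPairModular   -- ★-to-be F0P3-p01 (g14): VERTEX pair (brings ★ EDGE pair p843849, ★ α4, ★ α1, ★ parity rider)
import Literature.NumberTheory.Rogawski1990.RankOneKappaVertexCoverCM                          -- ★ p843629 ED. 2: `exists_vertexCover_of_ramified`
import Literature.NumberTheory.Rogawski1990.RankOneUnstableTransferInertCoreAssembly            -- ★ p843367: `exists_pieces_integral_conj_sub_map_eq_sum`
import Literature.NumberTheory.Rogawski1990.RankOneKappaLevelFamilyCM                           -- ★ p843749 S2-ram: `exists_level_data_onePlace_of_v_eq`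
import Literature.NumberTheory.Rogawski1990.RankOneUnstableRamifiedSignSeam                     -- ★-to-be A-p16 (g28): `neg_one_pow_bit_eq_edge`, `neg_one_pow_bit_eq_vertex`
import Literature.NumberTheory.Rogawski1990.RankOneTorusDepthContinuity                         -- ★ torus pack: `conjLocal_frameEntry_mul_self_apply`
import Literature.NumberTheory.Rogawski1990.RankOneTorusCoefficientLocalConstancy               -- ★ p843589 (this seat): `zpow_neg_mul_mem_integer_iff`
import Literature.NumberTheory.Rogawski1990.ExplicitFactorKappaAlmostEverywhereOne              -- ★ `conjLocal_apply_eq_galAdicCompletionMap`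
import Literature.NumberTheory.Automorphic.UnitaryRankTwoSignedNormalFormElementsModular        -- ★ p843801 B-p12 (g29): `exists_conj_signedNormalForm_elements_modular`
import Literature.NumberTheory.Automorphic.UnitaryRankTwoDepthValueLaw                          -- ★ `depthPred_anti`
import HarnessLib

/-!
# R-5b «PAIRS ON THE TORUS»: the END's `obtain`-glue — every hypothesis of ★ `rankOneUnstable_core_of_signedPairs` (p843850) except the torus `Δ`-law, PRODUCED at a
# tamely ramified place (road «R1-ram»; Labesse–Langlands 1979 §2 Lemma 2.1, Rogawski 1990 §4.9 Lemma 4.9.3, Kottwitz 1988 §2)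

Topic `NumberTheory/Rogawski1990`; namespace `Literature.NumberTheory.Rogawski1990`.  THEOREMS ONLY (no definition, no instance, no notation, no named fact, no `sorry`);
kernel lane `--supports stmt-HodgeConjecture-24833`.  Cell `pub/hodgecm-mathlib` (D-0151), crux H413, line «N6nsGerm», residue `RankOneUnstableTransferNonsplitCMERamified` of
#159; dealt by the END assembler F0P3a-p03 (g12) 11:17:00Z («(iii) R5b PAIRS ON THE TORUS»; architect A-p16 RULINGS A-25∕A-27∕A-29).
HONEST LABEL: HC_CM is proved only modulo the 2 remaining named inputs (hLiu418, h413) until rung 0 closes; this file is the composition of ★ theorems and asserts nothing printed.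

WHAT IT DOES.  With the END's one-place data as BINDERS (an anti-fixed uniformiser `ϖ`, the `σO`-package, the non-square unit `u`∕`η`, the partner `e` with its conjugation law
`hconj` and stable conjugacy `hest` (★ R-0c), a torus frame `Q` at `w` along `Z(t₀)` with UNIT diagonal Gram (★ A-p01 R2-E + eigenframe transfer)), it PRODUCES, in the
binder order of ★ `rankOneUnstable_core_of_signedPairs`: the cover pieces `φ_k` (★ `exists_vertexCover_of_ramified` + ★ `exists_pieces_integral_conj_sub_map_eq_sum`), the common
window `m = m₀ + 1` with the level-`m` right invariance (★ S2-ram at `m₀`; one step up so that BOTH the plain and the `D_ϖ`-conjugated membership laws hold), the value families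
(★ α1 `exists_unitary_signedNormalForm_elements` on odd `i` for edge pieces, ★ B-p12 `exists_conj_signedNormalForm_elements_modular` on even `i` for vertex pieces, the scalar
element elsewhere), the parity∕sign∕weight bookkeeping `par σ r A c`, the depth parity (★ `odd_of_valuation_sub_eq_of_norm_one`), the D-sign `εD` DEFINED by its residue test
(spec = ★ A-p19 R-4c⁺ ED. 2's hypothesis verbatim, `θ₀ := h 0`), and per piece the PAIR (★ `depthExpansion_pair_ramified_selfDual` ∕ ★ `…_modular`) with the bits' sign law
in the fold's currency (★ A-p16 «sign seam» `neg_one_pow_bit_eq_edge` ∕ `_vertex`, `s₀ = [res_w (−1)]`).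

* §0 `coe_glDiagonal_one_unit_eq` (`↑D_ϖ = !![1,0;0,ϖ]`), `level_of_conj_glDiagonal_level_succ_of_v_le_one` (the conjugated level law one step up gives the plain one; ramified
  twin of ★ `level_of_conj_glDiagonal_level_succ`), `windowWeight_eq_ite` (the PAIR's literal window weight on `i < m ≤ N`).
* §1 **`exists_signedPairs_of_ramified_tame`** — the glue.

## References
* [LabesseLanglands1979] J.-P. Labesse, R. P. Langlands, *L-indistinguishability for SL(2)*, Canad. J. Math. 31 (1979): §2 Lemma 2.1 pp. 8–9.
* [Rogawski1990] J. D. Rogawski, *Automorphic Representations of Unitary Groups in Three Variables*, Ann. of Math. Stud. 123 (1990): §4.9 Lemma 4.9.3 p. 56; §12.6 p. 174.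
* [Kottwitz1988] R. E. Kottwitz, *Tamagawa numbers*, Ann. of Math. 127 (1988): §2.
-/

set_option autoImplicit false

noncomputable section

open Set Filter Topology MeasureTheory NumberField IsDedekindDomain Finset Matrix ValuativeRel Function MulAction
open scoped Matrix MatrixGroups ValuativeRel WithZero

namespace Literature.NumberTheory.Rogawski1990

open Literature.NumberTheory.Automorphic Literature.NumberTheory.Automorphic.UnitaryGroup Literature.NumberTheory.GaloisRepresentations

/-! ## §0 Bookkeeping -/

/-- **The PAIR's literal window weight equals the fold's weight on the window** (`i < m ≤ N`: `i ≤ N` holds and `N − i ≠ 0`). [cite: LabesseLanglands1979, §2 p. 9] -/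
theorem windowWeight_eq_ite (q par : ℕ) {N m i : ℕ} (hi : i < m) (hmN : m ≤ N) :
    (if i ≤ N ∧ (N - i) % 2 = par then (if N - i = 0 then 1 else 2 * q ^ ((N - i) / 2)) else 0) =
      (if (N - i) % 2 = par then 2 * q ^ ((N - i) / 2) else 0) := by
  have hiN : i ≤ N := by omega
  have hNi : ¬ N - i = 0 := by omega
  by_cases hp : (N - i) % 2 = par
  · rw [if_pos ⟨hiN, hp⟩, if_pos hp, if_neg hNi]
  · rw [if_neg (fun h => hp h.2), if_neg hp]

section Level

variable (L : Type) [Field L] [NumberField L] [IsCMField L] (v : HeightOneSpectrum (𝓞 ↥(maximalRealSubfield L))) (w : PlacesOver L v)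

omit [IsCMField L] in
/-- `↑(glDiagonal ![1, ϖ]) = !![1, 0; 0, ϖ]`. [cite: Rogawski1990, §12.6 p. 174] -/
theorem coe_glDiagonal_one_unit_eq (ϖ : ((w.1.adicCompletion L))ˣ) :
    (((glDiagonal 2 (w.1.adicCompletion L) ![1, ϖ]) : GL (Fin 2) (w.1.adicCompletion L)) : Matrix (Fin 2) (Fin 2) (w.1.adicCompletion L)) = !![1, 0; 0, (ϖ : (w.1.adicCompletion L))] := by
  rw [coe_glDiagonal]
  ext i j
  fin_cases i <;> fin_cases j <;> simp

omit [IsCMField L] in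
/-- **The conjugated level law one step up implies the plain one** (ramified∕any-unit twin of ★ `level_of_conj_glDiagonal_level_succ`): if `ϖ^{−(m+1)}(D_ϖ⁻¹ y D_ϖ − 1)` is
integral then `ϖ^{−m}(y − 1)` is integral (`D_ϖ = diag(1, ϖ)`, `|ϖ| ≤ 1`). [cite: Rogawski1990, §12.6 p. 174] [cite: Kottwitz1988, §2] -/
theorem level_of_conj_glDiagonal_level_succ_of_v_le_one (ϖ : ((w.1.adicCompletion L))ˣ) (hϖ1 : Valued.v (ϖ : (w.1.adicCompletion L)) ≤ 1) {m : ℕ} (y : GL (Fin 2) (w.1.adicCompletion L))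
    (h : ∀ r s, (ϖ : (w.1.adicCompletion L)) ^ (-((m + 1 : ℕ) : ℤ)) * (((((glDiagonal 2 (w.1.adicCompletion L) ![1, ϖ])⁻¹ * y * (glDiagonal 2 (w.1.adicCompletion L) ![1, ϖ]) : GL (Fin 2) (w.1.adicCompletion L))) : Matrix (Fin 2) (Fin 2) (w.1.adicCompletion L)) - 1) r s ∈ 𝒪[(w.1.adicCompletion L)]) :
    ∀ r s, (ϖ : (w.1.adicCompletion L)) ^ (-(m : ℤ)) * (((y : Matrix (Fin 2) (Fin 2) (w.1.adicCompletion L))) - 1) r s ∈ 𝒪[(w.1.adicCompletion L)] := by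
  have hϖ0 : (ϖ : (w.1.adicCompletion L)) ≠ 0 := ϖ.ne_zero
  have hvϖ0 : (Valued.v (ϖ : (w.1.adicCompletion L)) : ℤᵐ⁰) ≠ 0 := (Valuation.ne_zero_iff _).2 hϖ0
  have hpos : (0 : ℤᵐ⁰) < Valued.v (ϖ : (w.1.adicCompletion L)) := zero_lt_iff.2 hvϖ0
  have hD : (((glDiagonal 2 (w.1.adicCompletion L) ![1, ϖ]) : GL (Fin 2) (w.1.adicCompletion L)) : Matrix (Fin 2) (Fin 2) (w.1.adicCompletion L)) = diagonal fun k => ((![1, ϖ] k : ((w.1.adicCompletion L))ˣ) : (w.1.adicCompletion L)) := coe_glDiagonal 2 (w.1.adicCompletion L) _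
  have hDi : ((((glDiagonal 2 (w.1.adicCompletion L) ![1, ϖ]))⁻¹ : GL (Fin 2) (w.1.adicCompletion L)) : Matrix (Fin 2) (Fin 2) (w.1.adicCompletion L)) = diagonal fun k => (((![1, ϖ])⁻¹ k : ((w.1.adicCompletion L))ˣ) : (w.1.adicCompletion L)) := by
    rw [← map_inv, coe_glDiagonal]
  have hconj : ((((glDiagonal 2 (w.1.adicCompletion L) ![1, ϖ])⁻¹ * y * (glDiagonal 2 (w.1.adicCompletion L) ![1, ϖ]) : GL (Fin 2) (w.1.adicCompletion L))) : Matrix (Fin 2) (Fin 2) (w.1.adicCompletion L)) - 1 =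
      ((((glDiagonal 2 (w.1.adicCompletion L) ![1, ϖ]))⁻¹ : GL (Fin 2) (w.1.adicCompletion L)) : Matrix (Fin 2) (Fin 2) (w.1.adicCompletion L)) * (((y : Matrix (Fin 2) (Fin 2) (w.1.adicCompletion L))) - 1) * (((glDiagonal 2 (w.1.adicCompletion L) ![1, ϖ]) : GL (Fin 2) (w.1.adicCompletion L)) : Matrix (Fin 2) (Fin 2) (w.1.adicCompletion L)) := by
    rw [Units.val_mul, Units.val_mul, Matrix.mul_sub, Matrix.sub_mul, Matrix.mul_one, Units.inv_mul]
  have hz : ∀ r s, Valued.v (((((![1, ϖ])⁻¹ r : ((w.1.adicCompletion L))ˣ) : (w.1.adicCompletion L)) * (((y : Matrix (Fin 2) (Fin 2) (w.1.adicCompletion L))) - 1) r s * ((![1, ϖ] s : ((w.1.adicCompletion L))ˣ) : (w.1.adicCompletion L)))) ≤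
      Valued.v (ϖ : (w.1.adicCompletion L)) ^ (m + 1) := fun r s => by
    have h' := h r s
    rw [hconj, hD, hDi, Matrix.mul_diagonal, Matrix.diagonal_mul, zpow_neg_mul_mem_integer_iff hϖ0] at h'
    exact h'
  intro r s
  rw [zpow_neg_mul_mem_integer_iff hϖ0]
  have hmm : Valued.v (ϖ : (w.1.adicCompletion L)) ^ (m + 1) ≤ Valued.v (ϖ : (w.1.adicCompletion L)) ^ m := pow_le_pow_right_of_le_one' hϖ1 (Nat.le_succ m)
  fin_cases r <;> fin_cases s
  · have h00 := hz 0 0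
    simp only [Fin.isValue, Pi.inv_apply, Matrix.cons_val_zero, inv_one, Units.val_one, one_mul, mul_one] at h00
    exact h00.trans hmm
  · have h01 := hz 0 1
    simp only [Fin.isValue, Pi.inv_apply, Matrix.cons_val_zero, Matrix.cons_val_one, Matrix.cons_val_fin_one, inv_one, Units.val_one, one_mul,
      map_mul, pow_succ] at h01
    exact (mul_le_mul_iff_left₀ hpos).1 h01
  · have h10 := hz 1 0
    simp only [Fin.isValue, Pi.inv_apply, Matrix.cons_val_zero, Matrix.cons_val_one, Matrix.cons_val_fin_one, Units.val_one, mul_one, Units.val_inv_eq_inv_val,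
      map_mul, map_inv₀] at h10
    rw [inv_mul_le_iff₀ hpos] at h10
    exact (h10.trans (mul_le_of_le_one_left zero_le hϖ1)).trans hmm
  · have h11 := hz 1 1
    simp only [Fin.isValue, Pi.inv_apply, Matrix.cons_val_one, Matrix.cons_val_fin_one, Units.val_inv_eq_inv_val, map_mul, map_inv₀] at h11
    rw [mul_comm ((Valued.v (ϖ : (w.1.adicCompletion L))))⁻¹ _, mul_assoc, inv_mul_cancel₀ hvϖ0, mul_one] at h11
    exact h11.trans hmm

end Level

/-! ## §1 The glue -/

section Glue

variable (L : Type) [Field L] [NumberField L] [IsCMField L] (v : HeightOneSpectrum (𝓞 ↥(maximalRealSubfield L)))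
  (w : PlacesOver L v) (hw : IsCMField.complexConj L • w.1 = w.1)
  [MeasurableSpace ((cmDatum L 2 (Matrix.of fun i j : Fin 2 => if i.val + j.val + 1 = 2 then (1 : L) else 0)).Local v × (cmDatum L 1 (Matrix.of fun i j : Fin 1 => if i.val + j.val + 1 = 1 then (1 : L) else 0)).Local v)] [BorelSpace ((cmDatum L 2 (Matrix.of fun i j : Fin 2 => if i.val + j.val + 1 = 2 then (1 : L) else 0)).Local v × (cmDatum L 1 (Matrix.of fun i j : Fin 1 => if i.val + j.val + 1 = 1 then (1 : L) else 0)).Local v)] (ν : Measure ((cmDatum L 2 (Matrix.of fun i j : Fin 2 => if i.val + j.val + 1 = 2 then (1 : L) else 0)).Local v × (cmDatum L 1 (Matrix.of fun i j : Fin 1 => if i.val + j.val + 1 = 1 then (1 : L) else 0)).Local v)) [ν.IsHaarMeasure] [ν.IsMulRightInvariant]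
  (f : ((cmDatum L 2 (Matrix.of fun i j : Fin 2 => if i.val + j.val + 1 = 2 then (1 : L) else 0)).Local v × (cmDatum L 1 (Matrix.of fun i j : Fin 1 => if i.val + j.val + 1 = 1 then (1 : L) else 0)).Local v) → ℂ) (hf : IsLocSmooth f)
  (t₀ : ((cmDatum L 2 (Matrix.of fun i j : Fin 2 => if i.val + j.val + 1 = 2 then (1 : L) else 0)).Local v × (cmDatum L 1 (Matrix.of fun i j : Fin 1 => if i.val + j.val + 1 = 1 then (1 : L) else 0)).Local v)) (P : GL (Fin 2) (LocalRing L v)) (d : Fin 2 → LocalRing L v) (ht₀ : IsRegularElt (t₀.1.val : GL (Fin 2) (LocalRing L v)))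
  (hP : (t₀.1.val.val : Matrix (Fin 2) (Fin 2) (LocalRing L v)) * P.val = P.val * Matrix.diagonal d) (hd1 : ∀ i, conjLocal L (IsCMField.complexConj L) v (d i) * d i = 1)

open scoped Classical in
-- `L_w`-sized statement: elaboration budget only (no search)
set_option maxHeartbeats 1600000 in
include hw hf ht₀ hP hd1 in
/-- **R-5b «PAIRS ON THE TORUS» — the END's `obtain`-glue.**  See the module docstring: output = the hypotheses `hφk hsum hψ hX hc hc' hNodd hpair` of
★ `rankOneUnstable_core_of_signedPairs` (in that order, `m := m₀ + 1`, `E₂` any one-place model reading `localNonsplitEquiv` on matrices (`hE₂`; the END takes `E₂ := localNonsplitEquiv`, `hE₂ := fun _ => rfl`), `s₀ := [res_w (−1)]`, `q := #(𝓞_{L⁺} ⧸ v)`) plus, before `hpair`, the residue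
SPEC of the D-sign `εD` in ★ A-p19's R-4c⁺ ED. 2 currency (`θ₀ := h 0`).  Binders: the END's one-place data (see §1 of ★ `depthExpansion_pair_ramified_selfDual`), the frame
`Q` ALONG `Z(t₀)` (`hQ : ∀ t`, from ★ A-p01 at `t₀` + the eigenframe transfer), and R-0c's `hest`.
[cite: LabesseLanglands1979, §2 Lemma 2.1 pp. 8–9] [cite: Rogawski1990, §4.9 Lemma 4.9.3 (4.9.2) p. 56] [cite: Kottwitz1988, §2] -/
theorem exists_signedPairs_of_ramified_tame
    (he : v.asIdeal.ramificationIdx' w.1.asIdeal ≠ 1) (h2 : Valued.v (2 : (w.1.adicCompletion L)) = 1)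
    (ϖ : ((w.1.adicCompletion L))ˣ) (hϖ : Valued.v (ϖ : (w.1.adicCompletion L)) = WithZero.exp (-1 : ℤ)) (hσϖ : (galAdicCompletionMap (L := L) (IsCMField.complexConj L) hw) (ϖ : (w.1.adicCompletion L)) = -(ϖ : (w.1.adicCompletion L)))
    (σO : 𝒪[(w.1.adicCompletion L)] →+* 𝒪[(w.1.adicCompletion L)]) (hσO' : ∀ x : 𝒪[(w.1.adicCompletion L)], ((σO x : 𝒪[(w.1.adicCompletion L)]) : (w.1.adicCompletion L)) = (galAdicCompletionMap (L := L) (IsCMField.complexConj L) hw) x) (hσσ : ∀ x, σO (σO x) = x)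
    (hres : ∀ x : 𝒪[(w.1.adicCompletion L)], σO x - x ∈ IsLocalRing.maximalIdeal 𝒪[(w.1.adicCompletion L)])
    (u : ((w.1.adicCompletion L))ˣ) (hvu : Valued.v (u : (w.1.adicCompletion L)) = 1) (hσu : (galAdicCompletionMap (L := L) (IsCMField.complexConj L) hw) (u : (w.1.adicCompletion L)) = u)
    {η : 𝒪[(w.1.adicCompletion L)]} (hηu' : (η : (w.1.adicCompletion L)) = (u : (w.1.adicCompletion L))) (hηu : IsUnit η) (hση : σO η = η) (hη : ¬ IsSquare (IsLocalRing.residue 𝒪[(w.1.adicCompletion L)] η))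
    (E₂ : (cmDatum L 2 (Matrix.of fun i j : Fin 2 => if i.val + j.val + 1 = 2 then (1 : L) else 0)).Local v ≃ₜ* ↥(unitaryGroupOfForm (galAdicCompletionMap (L := L) (IsCMField.complexConj L) hw) (placeForm (Matrix.of fun i j : Fin 2 => if i.val + j.val + 1 = 2 then (1 : L) else 0) w.1))) (hE₂ : ∀ g, ((E₂ g : ↥(unitaryGroupOfForm (galAdicCompletionMap (L := L) (IsCMField.complexConj L) hw) (placeForm (Matrix.of fun i j : Fin 2 => if i.val + j.val + 1 = 2 then (1 : L) else 0) w.1))) : GL (Fin 2) (w.1.adicCompletion L)) = ((localNonsplitEquiv (IsCMField.complexConj L) (Matrix.of fun i j : Fin 2 => if i.val + j.val + 1 = 2 then (1 : L) else 0) (IsCMField.complexConj_ne_one L) w hw g : ↥(unitaryGroupOfForm (galAdicCompletionMap (L := L) (IsCMField.complexConj L) hw) (placeForm (Matrix.of fun i j : Fin 2 => if i.val + j.val + 1 = 2 then (1 : L) else 0) w.1))) : GL (Fin 2) (w.1.adicCompletion L)))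
    (e : ((cmDatum L 2 (Matrix.of fun i j : Fin 2 => if i.val + j.val + 1 = 2 then (1 : L) else 0)).Local v × (cmDatum L 1 (Matrix.of fun i j : Fin 1 => if i.val + j.val + 1 = 1 then (1 : L) else 0)).Local v) ≃ₜ* ((cmDatum L 2 (Matrix.of fun i j : Fin 2 => if i.val + j.val + 1 = 2 then (1 : L) else 0)).Local v × (cmDatum L 1 (Matrix.of fun i j : Fin 1 => if i.val + j.val + 1 = 1 then (1 : L) else 0)).Local v)) (he2 : ∀ a : ((cmDatum L 2 (Matrix.of fun i j : Fin 2 => if i.val + j.val + 1 = 2 then (1 : L) else 0)).Local v × (cmDatum L 1 (Matrix.of fun i j : Fin 1 => if i.val + j.val + 1 = 1 then (1 : L) else 0)).Local v), (e a).2 = a.2)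
    (hconj : ∀ a : ((cmDatum L 2 (Matrix.of fun i j : Fin 2 => if i.val + j.val + 1 = 2 then (1 : L) else 0)).Local v × (cmDatum L 1 (Matrix.of fun i j : Fin 1 => if i.val + j.val + 1 = 1 then (1 : L) else 0)).Local v), ((E₂ (e a).1 : ↥(unitaryGroupOfForm (galAdicCompletionMap (L := L) (IsCMField.complexConj L) hw) (placeForm (Matrix.of fun i j : Fin 2 => if i.val + j.val + 1 = 2 then (1 : L) else 0) w.1))) : GL (Fin 2) (w.1.adicCompletion L)) = (glDiagonal 2 (w.1.adicCompletion L) ![1, u]) * ((E₂ a.1 : ↥(unitaryGroupOfForm (galAdicCompletionMap (L := L) (IsCMField.complexConj L) hw) (placeForm (Matrix.of fun i j : Fin 2 => if i.val + j.val + 1 = 2 then (1 : L) else 0) w.1))) : GL (Fin 2) (w.1.adicCompletion L)) * ((glDiagonal 2 (w.1.adicCompletion L) ![1, u]))⁻¹)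
    (hest : ∀ t : ↥(Subgroup.centralizer ({t₀} : Set ((cmDatum L 2 (Matrix.of fun i j : Fin 2 => if i.val + j.val + 1 = 2 then (1 : L) else 0)).Local v × (cmDatum L 1 (Matrix.of fun i j : Fin 1 => if i.val + j.val + 1 = 1 then (1 : L) else 0)).Local v))), IsRegularElt (((t : ((cmDatum L 2 (Matrix.of fun i j : Fin 2 => if i.val + j.val + 1 = 2 then (1 : L) else 0)).Local v × (cmDatum L 1 (Matrix.of fun i j : Fin 1 => if i.val + j.val + 1 = 1 then (1 : L) else 0)).Local v))).1.val : GL (Fin 2) (LocalRing L v)) → IsLocalStablyConjH L v (t : ((cmDatum L 2 (Matrix.of fun i j : Fin 2 => if i.val + j.val + 1 = 2 then (1 : L) else 0)).Local v × (cmDatum L 1 (Matrix.of fun i j : Fin 1 => if i.val + j.val + 1 = 1 then (1 : L) else 0)).Local v)) (e (t : ((cmDatum L 2 (Matrix.of fun i j : Fin 2 => if i.val + j.val + 1 = 2 then (1 : L) else 0)).Local v × (cmDatum L 1 (Matrix.of fun i j : Fin 1 => if i.val + j.val + 1 = 1 then (1 : L) else 0)).Local v))))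
    (Q : GL (Fin 2) (w.1.adicCompletion L)) (hQ : ∀ t : ↥(Subgroup.centralizer ({t₀} : Set ((cmDatum L 2 (Matrix.of fun i j : Fin 2 => if i.val + j.val + 1 = 2 then (1 : L) else 0)).Local v × (cmDatum L 1 (Matrix.of fun i j : Fin 1 => if i.val + j.val + 1 = 1 then (1 : L) else 0)).Local v))), (((E₂ ((t : ((cmDatum L 2 (Matrix.of fun i j : Fin 2 => if i.val + j.val + 1 = 2 then (1 : L) else 0)).Local v × (cmDatum L 1 (Matrix.of fun i j : Fin 1 => if i.val + j.val + 1 = 1 then (1 : L) else 0)).Local v))).1 : ↥(unitaryGroupOfForm (galAdicCompletionMap (L := L) (IsCMField.complexConj L) hw) (placeForm (Matrix.of fun i j : Fin 2 => if i.val + j.val + 1 = 2 then (1 : L) else 0) w.1))) : GL (Fin 2) (w.1.adicCompletion L)) : Matrix (Fin 2) (Fin 2) (w.1.adicCompletion L)) * (Q : Matrix (Fin 2) (Fin 2) (w.1.adicCompletion L)) = (Q : Matrix (Fin 2) (Fin 2) (w.1.adicCompletion L)) * diagonal ![(((P⁻¹).val * ((t : ((cmDatum L 2 (Matrix.of fun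 i j : Fin 2 => if i.val + j.val + 1 = 2 then (1 : L) else 0)).Local v × (cmDatum L 1 (Matrix.of fun i j : Fin 1 => if i.val + j.val + 1 = 1 then (1 : L) else 0)).Local v)).1.val.val : Matrix (Fin 2) (Fin 2) (LocalRing L v)) * P.val) 0 0) w, (((P⁻¹).val * ((t : ((cmDatum L 2 (Matrix.of fun i j : Fin 2 => if i.val + j.val + 1 = 2 then (1 : L) else 0)).Local v × (cmDatum L 1 (Matrix.of fun i j : Fin 1 => if i.val + j.val + 1 = 1 then (1 : L) else 0)).Local v)).1.val.val : Matrix (Fin 2) (Fin 2) (LocalRing L v)) * P.val) 1 1) w])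
    {h : Fin 2 → (w.1.adicCompletion L)} (hQh : formCongr (galAdicCompletionMap (L := L) (IsCMField.complexConj L) hw) Q (placeForm (Matrix.of fun i j : Fin 2 => if i.val + j.val + 1 = 2 then (1 : L) else 0) w.1) = Matrix.diagonal h) (hh : ∀ i, Valued.v (h i) = 1) (hσh : ∀ i, (galAdicCompletionMap (L := L) (IsCMField.complexConj L) hw) (h i) = h i)
    (r : 𝒪[(w.1.adicCompletion L)]) (hr : h 0 * (r : (w.1.adicCompletion L)) = -h 1) (hsq : IsSquare (IsLocalRing.residue 𝒪[(w.1.adicCompletion L)] r)) :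
    ∃ (n : ℕ) (φk : Fin n → ((cmDatum L 2 (Matrix.of fun i j : Fin 2 => if i.val + j.val + 1 = 2 then (1 : L) else 0)).Local v × (cmDatum L 1 (Matrix.of fun i j : Fin 1 => if i.val + j.val + 1 = 1 then (1 : L) else 0)).Local v) → ℂ) (m : ℕ) (Xm : ↥(Subgroup.centralizer ({t₀} : Set ((cmDatum L 2 (Matrix.of fun i j : Fin 2 => if i.val + j.val + 1 = 2 then (1 : L) else 0)).Local v × (cmDatum L 1 (Matrix.of fun i j : Fin 1 => if i.val + j.val + 1 = 1 then (1 : L) else 0)).Local v))) → ↥(unitaryGroupOfForm (galAdicCompletionMap (L := L) (IsCMField.complexConj L) hw) (placeForm (Matrix.of fun i j : Fin 2 => if i.val + j.val + 1 = 2 then (1 : L) else 0) w.1))) (M : Fin n → ℕ → ℕ → Matrix (Fin 2) (Fin 2) (w.1.adicCompletion L)) (X : Fin n → ↥(Subgroup.centralizer ({t₀} : Set ((cmDatum L 2 (Matrix.of fun i j : Fin 2 => if i.val + j.val + 1 = 2 then (1 : L) else 0)).Local v × (cmDatum L 1 (Matrix.of fun i j : Fin 1 => if i.val + j.val + 1 =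 1 then (1 : L) else 0)).Local v))) → ℕ → ℕ → ↥(unitaryGroupOfForm (galAdicCompletionMap (L := L) (IsCMField.complexConj L) hw) (placeForm (Matrix.of fun i j : Fin 2 => if i.val + j.val + 1 = 2 then (1 : L) else 0) w.1)))
      (par : Fin n → ℕ) (σ : Fin n → ℂ) (r' : Fin n → ℝ) (A : Fin n → ℕ → ℕ) (c : Fin n → ℕ → ℕ → ℕ) (εD : ↥(Subgroup.centralizer ({t₀} : Set ((cmDatum L 2 (Matrix.of fun i j : Fin 2 => if i.val + j.val + 1 = 2 then (1 : L) else 0)).Local v × (cmDatum L 1 (Matrix.of fun i j : Fin 1 => if i.val + j.val + 1 = 1 then (1 : L) else 0)).Local v))) → ℂ),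
      (∀ k, IsLocallyConstant (φk k)) ∧
      (∀ t : ↥(Subgroup.centralizer ({t₀} : Set ((cmDatum L 2 (Matrix.of fun i j : Fin 2 => if i.val + j.val + 1 = 2 then (1 : L) else 0)).Local v × (cmDatum L 1 (Matrix.of fun i j : Fin 1 => if i.val + j.val + 1 = 1 then (1 : L) else 0)).Local v))), IsRegularElt ((t : ((cmDatum L 2 (Matrix.of fun i j : Fin 2 => if i.val + j.val + 1 = 2 then (1 : L) else 0)).Local v × (cmDatum L 1 (Matrix.of fun i j : Fin 1 => if i.val + j.val + 1 = 1 then (1 : L) else 0)).Local v)).1.val : GL (Fin 2) (LocalRing L v)) →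
        ((∫ y, f (y * (t : ((cmDatum L 2 (Matrix.of fun i j : Fin 2 => if i.val + j.val + 1 = 2 then (1 : L) else 0)).Local v × (cmDatum L 1 (Matrix.of fun i j : Fin 1 => if i.val + j.val + 1 = 1 then (1 : L) else 0)).Local v)) * y⁻¹) ∂ν) - ∫ y, f (y * e (t : ((cmDatum L 2 (Matrix.of fun i j : Fin 2 => if i.val + j.val + 1 = 2 then (1 : L) else 0)).Local v × (cmDatum L 1 (Matrix.of fun i j : Fin 1 => if i.val + j.val + 1 = 1 then (1 : L) else 0)).Local v)) * y⁻¹) ∂ν) =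
          ∑ k, ((∫ y, φk k (y * (t : ((cmDatum L 2 (Matrix.of fun i j : Fin 2 => if i.val + j.val + 1 = 2 then (1 : L) else 0)).Local v × (cmDatum L 1 (Matrix.of fun i j : Fin 1 => if i.val + j.val + 1 = 1 then (1 : L) else 0)).Local v)) * y⁻¹) ∂ν) - ∫ y, φk k (y * e (t : ((cmDatum L 2 (Matrix.of fun i j : Fin 2 => if i.val + j.val + 1 = 2 then (1 : L) else 0)).Local v × (cmDatum L 1 (Matrix.of fun i j : Fin 1 => if i.val + j.val + 1 = 1 then (1 : L) else 0)).Local v)) * y⁻¹) ∂ν)) ∧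
      (∀ (k : Fin n) (x : ((cmDatum L 2 (Matrix.of fun i j : Fin 2 => if i.val + j.val + 1 = 2 then (1 : L) else 0)).Local v × (cmDatum L 1 (Matrix.of fun i j : Fin 1 => if i.val + j.val + 1 = 1 then (1 : L) else 0)).Local v)) (y : ↥(unitaryGroupOfForm (galAdicCompletionMap (L := L) (IsCMField.complexConj L) hw) (placeForm (Matrix.of fun i j : Fin 2 => if i.val + j.val + 1 = 2 then (1 : L) else 0) w.1))), (∀ r s, (ϖ : (w.1.adicCompletion L)) ^ (-(m : ℤ)) * ((((y : ↥(unitaryGroupOfForm (galAdicCompletionMap (L := L) (IsCMField.complexConj L) hw) (placeForm (Matrix.of fun i j : Fin 2 => if i.val + j.val + 1 = 2 then (1 : L) else 0) w.1))) : GL (Fin 2) (w.1.adicCompletion L)) : Matrix (Fin 2) (Fin 2) (w.1.adicCompletion L)) - 1) r s ∈ 𝒪[(w.1.adicCompletion L)]) →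
        φk k (x * (E₂.symm y, 1)) = φk k x) ∧
      (∀ k t i b, (((X k t i b : ↥(unitaryGroupOfForm (galAdicCompletionMap (L := L) (IsCMField.complexConj L) hw) (placeForm (Matrix.of fun i j : Fin 2 => if i.val + j.val + 1 = 2 then (1 : L) else 0) w.1))) : GL (Fin 2) (w.1.adicCompletion L)) : Matrix (Fin 2) (Fin 2) (w.1.adicCompletion L)) = ((((P⁻¹).val * ((t : ((cmDatum L 2 (Matrix.of fun i j : Fin 2 => if i.val + j.val + 1 = 2 then (1 : L) else 0)).Local v × (cmDatum L 1 (Matrix.of fun i j : Fin 1 => if i.val + j.val + 1 = 1 then (1 : L) else 0)).Local v)).1.val.val : Matrix (Fin 2) (Fin 2) (LocalRing L v)) * P.val) 1 1) w) • M k i b) ∧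
      (∀ k N, ∀ i ∈ Finset.range m, (N - i) % 2 = par k → c k N i = 2 * (Nat.card (𝓞 ↥(maximalRealSubfield L) ⧸ v.asIdeal)) ^ ((N - i) / 2)) ∧
      (∀ k N, ∀ i ∈ Finset.range m, ¬ (N - i) % 2 = par k → c k N i = 0) ∧
      (∀ t : ↥(Subgroup.centralizer ({t₀} : Set ((cmDatum L 2 (Matrix.of fun i j : Fin 2 => if i.val + j.val + 1 = 2 then (1 : L) else 0)).Local v × (cmDatum L 1 (Matrix.of fun i j : Fin 1 => if i.val + j.val + 1 = 1 then (1 : L) else 0)).Local v))), IsRegularElt ((t : ((cmDatum L 2 (Matrix.of fun i j : Fin 2 => if i.val + j.val + 1 = 2 then (1 : L) else 0)).Local v × (cmDatum L 1 (Matrix.of fun i j : Fin 1 => if i.val + j.val + 1 = 1 then (1 : L) else 0)).Local v)).1.val : GL (Fin 2) (LocalRing L v)) → m ≤ (-WithZero.log (Valued.v ((((P⁻¹).val * ((t : ((cmDatum L 2 (Matrix.of fun i j : Fin 2 => if i.val + j.val + 1 = 2 then (1 : L) else 0)).Local v × (cmDatum L 1 (Matrix.of fun i j : Fin 1 => if i.val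 + j.val + 1 = 1 then (1 : L) else 0)).Local v)).1.val.val : Matrix (Fin 2) (Fin 2) (LocalRing L v)) * P.val) 0 0 - ((P⁻¹).val * ((t : ((cmDatum L 2 (Matrix.of fun i j : Fin 2 => if i.val + j.val + 1 = 2 then (1 : L) else 0)).Local v × (cmDatum L 1 (Matrix.of fun i j : Fin 1 => if i.val + j.val + 1 = 1 then (1 : L) else 0)).Local v)).1.val.val : Matrix (Fin 2) (Fin 2) (LocalRing L v)) * P.val) 1 1) w))).toNat → (-WithZero.log (Valued.v ((((P⁻¹).val * ((t : ((cmDatum L 2 (Matrix.of fun i j : Fin 2 => if i.val + j.val + 1 = 2 then (1 : L) else 0)).Local v × (cmDatum L 1 (Matrix.of fun i j : Fin 1 => if i.val + j.val + 1 = 1 then (1 : L) else 0)).Local v)).1.val.val : Matrix (Fin 2) (Fin 2) (LocalRing L v)) * P.val) 0 0 - ((P⁻¹).val * ((t : ((cmDatum L 2 (Matrix.of fun i j : Fin 2 => if i.val + j.val + 1 = 2 then (1 : L) else 0)).Local v × (cmDatum L 1 (Matrix.of fun i j : Fin 1 => if i.val + j.val + 1 = 1 then (1 : L) else 0)).Local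 v)).1.val.val : Matrix (Fin 2) (Fin 2) (LocalRing L v)) * P.val) 1 1) w))).toNat % 2 = 1) ∧
      (∀ t : ↥(Subgroup.centralizer ({t₀} : Set ((cmDatum L 2 (Matrix.of fun i j : Fin 2 => if i.val + j.val + 1 = 2 then (1 : L) else 0)).Local v × (cmDatum L 1 (Matrix.of fun i j : Fin 1 => if i.val + j.val + 1 = 1 then (1 : L) else 0)).Local v))), IsRegularElt ((t : ((cmDatum L 2 (Matrix.of fun i j : Fin 2 => if i.val + j.val + 1 = 2 then (1 : L) else 0)).Local v × (cmDatum L 1 (Matrix.of fun i j : Fin 1 => if i.val + j.val + 1 = 1 then (1 : L) else 0)).Local v)).1.val : GL (Fin 2) (LocalRing L v)) → ∀ S : 𝒪[(w.1.adicCompletion L)],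
        (S : (w.1.adicCompletion L)) = (((P⁻¹).val * ((t : ((cmDatum L 2 (Matrix.of fun i j : Fin 2 => if i.val + j.val + 1 = 2 then (1 : L) else 0)).Local v × (cmDatum L 1 (Matrix.of fun i j : Fin 1 => if i.val + j.val + 1 = 1 then (1 : L) else 0)).Local v)).1.val.val : Matrix (Fin 2) (Fin 2) (LocalRing L v)) * P.val) 1 1) w * ((((P⁻¹).val * ((t : ((cmDatum L 2 (Matrix.of fun i j : Fin 2 => if i.val + j.val + 1 = 2 then (1 : L) else 0)).Local v × (cmDatum L 1 (Matrix.of fun i j : Fin 1 => if i.val + j.val + 1 = 1 then (1 : L) else 0)).Local v)).1.val.val : Matrix (Fin 2) (Fin 2) (LocalRing L v)) * P.val) 0 0 - ((P⁻¹).val * ((t : ((cmDatum L 2 (Matrix.of fun i j : Fin 2 => if i.val + j.val + 1 = 2 then (1 : L) else 0)).Local v × (cmDatum L 1 (Matrix.of fun i j : Fin 1 => if i.val + j.val + 1 = 1 then (1 : L) else 0)).Local v)).1.val.val : Matrix (Fin 2) (Fin 2) (LocalRing L v)) * P.val) 1 1) w * ((ϖ : (w.1.adicCompletion L)) ^ (-WithZero.log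 (Valued.v ((((P⁻¹).val * ((t : ((cmDatum L 2 (Matrix.of fun i j : Fin 2 => if i.val + j.val + 1 = 2 then (1 : L) else 0)).Local v × (cmDatum L 1 (Matrix.of fun i j : Fin 1 => if i.val + j.val + 1 = 1 then (1 : L) else 0)).Local v)).1.val.val : Matrix (Fin 2) (Fin 2) (LocalRing L v)) * P.val) 0 0 - ((P⁻¹).val * ((t : ((cmDatum L 2 (Matrix.of fun i j : Fin 2 => if i.val + j.val + 1 = 2 then (1 : L) else 0)).Local v × (cmDatum L 1 (Matrix.of fun i j : Fin 1 => if i.val + j.val + 1 = 1 then (1 : L) else 0)).Local v)).1.val.val : Matrix (Fin 2) (Fin 2) (LocalRing L v)) * P.val) 1 1) w))).toNat)⁻¹) * h 0 →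
          εD t = if IsSquare (IsLocalRing.residue 𝒪[(w.1.adicCompletion L)] S) then (1 : ℂ) else -1) ∧
      (∀ (k : Fin n) (t : ↥(Subgroup.centralizer ({t₀} : Set ((cmDatum L 2 (Matrix.of fun i j : Fin 2 => if i.val + j.val + 1 = 2 then (1 : L) else 0)).Local v × (cmDatum L 1 (Matrix.of fun i j : Fin 1 => if i.val + j.val + 1 = 1 then (1 : L) else 0)).Local v)))), IsRegularElt ((t : ((cmDatum L 2 (Matrix.of fun i j : Fin 2 => if i.val + j.val + 1 = 2 then (1 : L) else 0)).Local v × (cmDatum L 1 (Matrix.of fun i j : Fin 1 => if i.val + j.val + 1 = 1 then (1 : L) else 0)).Local v)).1.val : GL (Fin 2) (LocalRing L v)) → m ≤ (-WithZero.log (Valued.v ((((P⁻¹).val * ((t : ((cmDatum L 2 (Matrix.of fun i j : Fin 2 => if i.val + j.val + 1 = 2 then (1 : L) else 0)).Local v × (cmDatum L 1 (Matrix.of fun i j : Fin 1 => if i.val + j.val + 1 = 1 then (1 : L) else 0)).Local v)).1.val.val : Matrix (Fin 2) (Fin 2) (LocalRing L v)) * P.val) 0 0 - ((P⁻¹).val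 * ((t : ((cmDatum L 2 (Matrix.of fun i j : Fin 2 => if i.val + j.val + 1 = 2 then (1 : L) else 0)).Local v × (cmDatum L 1 (Matrix.of fun i j : Fin 1 => if i.val + j.val + 1 = 1 then (1 : L) else 0)).Local v)).1.val.val : Matrix (Fin 2) (Fin 2) (LocalRing L v)) * P.val) 1 1) w))).toNat →
        ∃ b : ℕ → ℕ, (∀ i, b i ≤ 1) ∧
          (∀ i ∈ Finset.range m, ((-WithZero.log (Valued.v ((((P⁻¹).val * ((t : ((cmDatum L 2 (Matrix.of fun i j : Fin 2 => if i.val + j.val + 1 = 2 then (1 : L) else 0)).Local v × (cmDatum L 1 (Matrix.of fun i j : Fin 1 => if i.val + j.val + 1 = 1 then (1 : L) else 0)).Local v)).1.val.val : Matrix (Fin 2) (Fin 2) (LocalRing L v)) * P.val) 0 0 - ((P⁻¹).val * ((t : ((cmDatum L 2 (Matrix.of fun i j : Fin 2 => if i.val + j.val + 1 = 2 then (1 : L) else 0)).Local v × (cmDatum L 1 (Matrix.of fun i j : Fin 1 => if i.val + j.val + 1 = 1 then (1 : L) else 0)).Local v)).1.val.val : Matrix (Fin 2) (Fin 2) (LocalRing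 L v)) * P.val) 1 1) w))).toNat - i) % 2 = par k → (-1 : ℂ) ^ (b i) = σ k * εD t * (if IsSquare (IsLocalRing.residue 𝒪[(w.1.adicCompletion L)] (-1)) then (1 : ℂ) else -1) ^ (((-WithZero.log (Valued.v ((((P⁻¹).val * ((t : ((cmDatum L 2 (Matrix.of fun i j : Fin 2 => if i.val + j.val + 1 = 2 then (1 : L) else 0)).Local v × (cmDatum L 1 (Matrix.of fun i j : Fin 1 => if i.val + j.val + 1 = 1 then (1 : L) else 0)).Local v)).1.val.val : Matrix (Fin 2) (Fin 2) (LocalRing L v)) * P.val) 0 0 - ((P⁻¹).val * ((t : ((cmDatum L 2 (Matrix.of fun i j : Fin 2 => if i.val + j.val + 1 = 2 then (1 : L) else 0)).Local v × (cmDatum L 1 (Matrix.of fun i j : Fin 1 => if i.val + j.val + 1 = 1 then (1 : L) else 0)).Local v)).1.val.val : Matrix (Fin 2) (Fin 2) (LocalRing L v)) * P.val) 1 1) w))).toNat + i + 1) / 2)) ∧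
          (∫ y, φk k (y * (t : ((cmDatum L 2 (Matrix.of fun i j : Fin 2 => if i.val + j.val + 1 = 2 then (1 : L) else 0)).Local v × (cmDatum L 1 (Matrix.of fun i j : Fin 1 => if i.val + j.val + 1 = 1 then (1 : L) else 0)).Local v)) * y⁻¹) ∂ν) = r' k • (A k (-WithZero.log (Valued.v ((((P⁻¹).val * ((t : ((cmDatum L 2 (Matrix.of fun i j : Fin 2 => if i.val + j.val + 1 = 2 then (1 : L) else 0)).Local v × (cmDatum L 1 (Matrix.of fun i j : Fin 1 => if i.val + j.val + 1 = 1 then (1 : L) else 0)).Local v)).1.val.val : Matrix (Fin 2) (Fin 2) (LocalRing L v)) * P.val) 0 0 - ((P⁻¹).val * ((t : ((cmDatum L 2 (Matrix.of fun i j : Fin 2 => if i.val + j.val + 1 = 2 then (1 : L) else 0)).Local v × (cmDatum L 1 (Matrix.of fun i j : Fin 1 => if i.val + j.val + 1 = 1 then (1 : L) else 0)).Local v)).1.val.val : Matrix (Fin 2) (Fin 2) (LocalRing L v)) * P.val) 1 1) w))).toNat • φk k (E₂.symm (Xm t), (t : ((cmDatum L 2 (Matrix.of fun i j : Fin 2 =>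 if i.val + j.val + 1 = 2 then (1 : L) else 0)).Local v × (cmDatum L 1 (Matrix.of fun i j : Fin 1 => if i.val + j.val + 1 = 1 then (1 : L) else 0)).Local v)).2) +
            ∑ i ∈ Finset.range m, c k (-WithZero.log (Valued.v ((((P⁻¹).val * ((t : ((cmDatum L 2 (Matrix.of fun i j : Fin 2 => if i.val + j.val + 1 = 2 then (1 : L) else 0)).Local v × (cmDatum L 1 (Matrix.of fun i j : Fin 1 => if i.val + j.val + 1 = 1 then (1 : L) else 0)).Local v)).1.val.val : Matrix (Fin 2) (Fin 2) (LocalRing L v)) * P.val) 0 0 - ((P⁻¹).val * ((t : ((cmDatum L 2 (Matrix.of fun i j : Fin 2 => if i.val + j.val + 1 = 2 then (1 : L) else 0)).Local v × (cmDatum L 1 (Matrix.of fun i j : Fin 1 => if i.val + j.val + 1 = 1 then (1 : L) else 0)).Local v)).1.val.val : Matrix (Fin 2) (Fin 2) (LocalRing L v)) * P.val) 1 1) w))).toNat i • φk k (E₂.symm (X k t i (b i)), (t : ((cmDatum L 2 (Matrix.of fun i j : Fin 2 => if i.val + j.val + 1 = 2 then (1 : L) else 0)).Local v × (cmDatum L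 1 (Matrix.of fun i j : Fin 1 => if i.val + j.val + 1 = 1 then (1 : L) else 0)).Local v)).2)) ∧
          (∫ y, φk k (y * e (t : ((cmDatum L 2 (Matrix.of fun i j : Fin 2 => if i.val + j.val + 1 = 2 then (1 : L) else 0)).Local v × (cmDatum L 1 (Matrix.of fun i j : Fin 1 => if i.val + j.val + 1 = 1 then (1 : L) else 0)).Local v)) * y⁻¹) ∂ν) = r' k • (A k (-WithZero.log (Valued.v ((((P⁻¹).val * ((t : ((cmDatum L 2 (Matrix.of fun i j : Fin 2 => if i.val + j.val + 1 = 2 then (1 : L) else 0)).Local v × (cmDatum L 1 (Matrix.of fun i j : Fin 1 => if i.val + j.val + 1 = 1 then (1 : L) else 0)).Local v)).1.val.val : Matrix (Fin 2) (Fin 2) (LocalRing L v)) * P.val) 0 0 - ((P⁻¹).val * ((t : ((cmDatum L 2 (Matrix.of fun i j : Fin 2 => if i.val + j.val + 1 = 2 then (1 : L) else 0)).Local v × (cmDatum L 1 (Matrix.of fun i j : Fin 1 => if i.val + j.val + 1 = 1 then (1 : L) else 0)).Local v)).1.val.val : Matrix (Fin 2) (Fin 2) (LocalRing L v)) * P.val)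 1 1) w))).toNat • φk k (E₂.symm (Xm t), (t : ((cmDatum L 2 (Matrix.of fun i j : Fin 2 => if i.val + j.val + 1 = 2 then (1 : L) else 0)).Local v × (cmDatum L 1 (Matrix.of fun i j : Fin 1 => if i.val + j.val + 1 = 1 then (1 : L) else 0)).Local v)).2) +
            ∑ i ∈ Finset.range m, c k (-WithZero.log (Valued.v ((((P⁻¹).val * ((t : ((cmDatum L 2 (Matrix.of fun i j : Fin 2 => if i.val + j.val + 1 = 2 then (1 : L) else 0)).Local v × (cmDatum L 1 (Matrix.of fun i j : Fin 1 => if i.val + j.val + 1 = 1 then (1 : L) else 0)).Local v)).1.val.val : Matrix (Fin 2) (Fin 2) (LocalRing L v)) * P.val) 0 0 - ((P⁻¹).val * ((t : ((cmDatum L 2 (Matrix.of fun i j : Fin 2 => if i.val + j.val + 1 = 2 then (1 : L) else 0)).Local v × (cmDatum L 1 (Matrix.of fun i j : Fin 1 => if i.val + j.val + 1 = 1 then (1 : L) else 0)).Local v)).1.val.val : Matrix (Fin 2) (Fin 2) (LocalRing L v)) * P.val) 1 1) w))).toNat i • φk k (E₂.symm (X k t i (1 - b i)), (t : ((cmDatum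 L 2 (Matrix.of fun i j : Fin 2 => if i.val + j.val + 1 = 2 then (1 : L) else 0)).Local v × (cmDatum L 1 (Matrix.of fun i j : Fin 1 => if i.val + j.val + 1 = 1 then (1 : L) else 0)).Local v)).2))) := by
  classical
  -- §a one-place data
  have hϖ0 : (ϖ : (w.1.adicCompletion L)) ≠ 0 := ϖ.ne_zero
  have hϖ' : IsUniformizingElement (ϖ : (w.1.adicCompletion L)) := isUniformizingElement_of_v_eq hϖ
  have hϖ1 : Valued.v (ϖ : (w.1.adicCompletion L)) ≤ 1 := by
    rw [hϖ, ← WithZero.exp_zero, WithZero.exp_le_exp]; norm_num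
  have hϖO : (ϖ : (w.1.adicCompletion L)) ∈ 𝒪[(w.1.adicCompletion L)] := (v_le_one_iff_mem_integer _).1 hϖ1
  have h2O : IsUnit (2 : 𝒪[(w.1.adicCompletion L)]) := by
    rw [(Valuation.integer.integers (valuation (w.1.adicCompletion L))).isUnit_iff_valuation_eq_one, map_ofNat]
    exact (v_eq_one_iff_valuation_eq_one (2 : (w.1.adicCompletion L))).1 h2
  have hJ : (placeForm (Matrix.of fun i j : Fin 2 => if i.val + j.val + 1 = 2 then (1 : L) else 0) w.1) = !![0, 1; 1, 0] := placeForm_antidiagTwo_eq_swap_lit L v w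
  have hD := coe_glDiagonal_one_unit_eq L v w ϖ
  have hσηL : (galAdicCompletionMap (L := L) (IsCMField.complexConj L) hw) ((η : 𝒪[(w.1.adicCompletion L)]) : (w.1.adicCompletion L)) = ((η : 𝒪[(w.1.adicCompletion L)]) : (w.1.adicCompletion L)) := by rw [hηu']; exact hσu
  -- §b the cover and the pieces (★ I-5a-ram ED. 2, ★ asm §3)
  obtain ⟨K₂, -, hd0, hd1', hK₂o, hK₂c, hcov⟩ := exists_vertexCover_of_ramified L v w hw he h2 ϖ hϖ hσϖ
  obtain ⟨n, ε, φk, hφk, hφkK, hφkinv, hsum⟩ := exists_pieces_integral_conj_sub_map_eq_sum L v w hw ν K₂ hK₂o hK₂c hcov hf t₀ P d ht₀ hP hd1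
  have hdict0 : ∀ g, g ∈ K₂ 0 ↔ E₂ g ∈ ((glInt 2 (w.1.adicCompletion L)).subgroupOf (unitaryGroupOfForm (galAdicCompletionMap (L := L) (IsCMField.complexConj L) hw) (placeForm (Matrix.of fun i j : Fin 2 => if i.val + j.val + 1 = 2 then (1 : L) else 0) w.1))) := fun g => by
    rw [Subgroup.mem_subgroupOf, hE₂]; exact hd0 g
  have hdict1 : ∀ g, g ∈ K₂ 1 ↔ E₂ g ∈ (((glInt 2 (w.1.adicCompletion L)).map (MulAut.conj (glDiagonal 2 (w.1.adicCompletion L) ![1, ϖ])).toMonoidHom).subgroupOf (unitaryGroupOfForm (galAdicCompletionMap (L := L) (IsCMField.complexConj L) hw) (placeForm (Matrix.of fun i j : Fin 2 => if i.val + j.val + 1 = 2 then (1 : L) else 0) w.1))) := fun g => by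
    rw [Subgroup.mem_subgroupOf, hE₂]; exact hd1' g
  have hε : ∀ k, ε k = 0 ∨ ε k = 1 := by
    intro k
    generalize ε k = x
    fin_cases x <;> simp
  -- §c ★ S2-ram: the common level `m₀`; the window is `m₀ + 1` (plain AND conjugated laws one step up)
  obtain ⟨m₀, -, hKm₀, hφm₀⟩ := exists_level_data_onePlace_of_v_eq L v w hw hϖ E₂ φk (fun k => (hφk k).1) (fun k => (hφk k).2)
  have hKmE : ∀ y : ↥(unitaryGroupOfForm (galAdicCompletionMap (L := L) (IsCMField.complexConj L) hw) (placeForm (Matrix.of fun i j : Fin 2 => if i.val + j.val + 1 = 2 then (1 : L) else 0) w.1)), (∀ r s, (ϖ : (w.1.adicCompletion L)) ^ (-((m₀ + 1 : ℕ) : ℤ)) * ((((y : ↥(unitaryGroupOfForm (galAdicCompletionMap (L := L) (IsCMField.complexConj L) hw) (placeForm (Matrix.of fun i j : Fin 2 => if i.val + j.val + 1 = 2 then (1 : L) else 0) w.1))) : GL (Fin 2) (w.1.adicCompletion L)) : Matrix (Fin 2) (Fin 2) (w.1.adicCompletion L)) - 1) r s ∈ 𝒪[(w.1.adicCompletion L)])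 →
      y ∈ (localCongruenceSubgroup 2 L w.1 m₀).subgroupOf (unitaryGroupOfForm (galAdicCompletionMap (L := L) (IsCMField.complexConj L) hw) (placeForm (Matrix.of fun i j : Fin 2 => if i.val + j.val + 1 = 2 then (1 : L) else 0) w.1)) := fun y hy =>
    hKm₀ y (fun r s => depthPred_anti hϖ' _ (Nat.le_succ m₀) hy r s)
  have hKmV : ∀ y : ↥(unitaryGroupOfForm (galAdicCompletionMap (L := L) (IsCMField.complexConj L) hw) (placeForm (Matrix.of fun i j : Fin 2 => if i.val + j.val + 1 = 2 then (1 : L) else 0) w.1)), (∀ r s, (ϖ : (w.1.adicCompletion L)) ^ (-((m₀ + 1 : ℕ) : ℤ)) *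
      (((((glDiagonal 2 (w.1.adicCompletion L) ![1, ϖ])⁻¹ * ((y : ↥(unitaryGroupOfForm (galAdicCompletionMap (L := L) (IsCMField.complexConj L) hw) (placeForm (Matrix.of fun i j : Fin 2 => if i.val + j.val + 1 = 2 then (1 : L) else 0) w.1))) : GL (Fin 2) (w.1.adicCompletion L)) * (glDiagonal 2 (w.1.adicCompletion L) ![1, ϖ]) : GL (Fin 2) (w.1.adicCompletion L))) : Matrix (Fin 2) (Fin 2) (w.1.adicCompletion L)) - 1) r s ∈ 𝒪[(w.1.adicCompletion L)]) →
      y ∈ (localCongruenceSubgroup 2 L w.1 m₀).subgroupOf (unitaryGroupOfForm (galAdicCompletionMap (L := L) (IsCMField.complexConj L) hw) (placeForm (Matrix.of fun i j : Fin 2 => if i.val + j.val + 1 = 2 then (1 : L) else 0) w.1)) := fun y hy =>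
    hKm₀ y (level_of_conj_glDiagonal_level_succ_of_v_le_one L v w ϖ hϖ1 ((y : ↥(unitaryGroupOfForm (galAdicCompletionMap (L := L) (IsCMField.complexConj L) hw) (placeForm (Matrix.of fun i j : Fin 2 => if i.val + j.val + 1 = 2 then (1 : L) else 0) w.1))) : GL (Fin 2) (w.1.adicCompletion L)) hy)
  have hS3 : ∀ (k : Fin n) (x : ((cmDatum L 2 (Matrix.of fun i j : Fin 2 => if i.val + j.val + 1 = 2 then (1 : L) else 0)).Local v × (cmDatum L 1 (Matrix.of fun i j : Fin 1 => if i.val + j.val + 1 = 1 then (1 : L) else 0)).Local v)) (y : ↥(unitaryGroupOfForm (galAdicCompletionMap (L := L) (IsCMField.complexConj L) hw) (placeForm (Matrix.of fun i j : Fin 2 => if i.val + j.val + 1 = 2 then (1 : L) else 0) w.1))), (∀ r s, (ϖ : (w.1.adicCompletion L)) ^ (-((m₀ + 1 : ℕ) : ℤ)) * ((((y : ↥(unitaryGroupOfForm (galAdicCompletionMap (L := L) (IsCMField.complexConj L) hw) (placeForm (Matrix.of fun i j : Fin 2 => if i.val + j.val + 1 = 2 then (1 : L) else 0) w.1))) :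 GL (Fin 2) (w.1.adicCompletion L)) : Matrix (Fin 2) (Fin 2) (w.1.adicCompletion L)) - 1) r s ∈ 𝒪[(w.1.adicCompletion L)]) →
      φk k (x * (E₂.symm y, 1)) = φk k x := by
    intro k x y hy
    have h := hφm₀ k x.2 (E₂ x.1) y (hKmE y hy)
    rw [map_mul, ContinuousMulEquiv.symm_apply_apply] at h
    have hx : x * (E₂.symm y, 1) = (x.1 * E₂.symm y, x.2) := Prod.ext rfl (mul_one _)
    rw [hx]
    exact h
  -- §d value families along the torus (★ α1 on odd `i`, ★ B-p12 rider on even `i`, the scalar element elsewhere)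
  have hcw : ∀ t : ↥(Subgroup.centralizer ({t₀} : Set ((cmDatum L 2 (Matrix.of fun i j : Fin 2 => if i.val + j.val + 1 = 2 then (1 : L) else 0)).Local v × (cmDatum L 1 (Matrix.of fun i j : Fin 1 => if i.val + j.val + 1 = 1 then (1 : L) else 0)).Local v))), (galAdicCompletionMap (L := L) (IsCMField.complexConj L) hw) ((((P⁻¹).val * ((t : ((cmDatum L 2 (Matrix.of fun i j : Fin 2 => if i.val + j.val + 1 = 2 then (1 : L) else 0)).Local v × (cmDatum L 1 (Matrix.of fun i j : Fin 1 => if i.val + j.val + 1 = 1 then (1 : L) else 0)).Local v)).1.val.val : Matrix (Fin 2) (Fin 2) (LocalRing L v)) * P.val) 1 1) w) * ((((P⁻¹).val * ((t : ((cmDatum L 2 (Matrix.of fun i j : Fin 2 => if i.val + j.val + 1 = 2 then (1 : L) else 0)).Local v × (cmDatum L 1 (Matrix.of fun i j : Fin 1 => if i.val + j.val + 1 = 1 then (1 : L) else 0)).Local v)).1.val.val : Matrix (Fin 2) (Fin 2) (LocalRing L v)) * P.val) 1 1) w) = 1 := fun t => by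
    have h := congrArg (fun x : LocalRing L v => x w) (conjLocal_frameEntry_mul_self_apply L v w hw t₀ P d ht₀ hP hd1 t 1)
    simpa only [Pi.mul_apply, Pi.one_apply, conjLocal_apply_eq_galAdicCompletionMap L v w hw] using h
  have hcv : ∀ t : ↥(Subgroup.centralizer ({t₀} : Set ((cmDatum L 2 (Matrix.of fun i j : Fin 2 => if i.val + j.val + 1 = 2 then (1 : L) else 0)).Local v × (cmDatum L 1 (Matrix.of fun i j : Fin 1 => if i.val + j.val + 1 = 1 then (1 : L) else 0)).Local v))), valuation (w.1.adicCompletion L) ((((P⁻¹).val * ((t : ((cmDatum L 2 (Matrix.of fun i j : Fin 2 => if i.val + j.val + 1 = 2 then (1 : L) else 0)).Local v × (cmDatum L 1 (Matrix.of fun i j : Fin 1 => if i.val + j.val + 1 = 1 then (1 : L) else 0)).Local v)).1.val.val : Matrix (Fin 2) (Fin 2) (LocalRing L v)) * P.val) 1 1) w) = 1 := fun t => valuation_eq_one_of_galAdicCompletionMap_mul_self L v w hw (hcw t)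
  have hexE : ∀ t : ↥(Subgroup.centralizer ({t₀} : Set ((cmDatum L 2 (Matrix.of fun i j : Fin 2 => if i.val + j.val + 1 = 2 then (1 : L) else 0)).Local v × (cmDatum L 1 (Matrix.of fun i j : Fin 1 => if i.val + j.val + 1 = 1 then (1 : L) else 0)).Local v))), ∃ (xm : ↥(unitaryGroupOfForm (galAdicCompletionMap (L := L) (IsCMField.complexConj L) hw) (placeForm (Matrix.of fun i j : Fin 2 => if i.val + j.val + 1 = 2 then (1 : L) else 0) w.1))) (x : ℕ → ℕ → ↥(unitaryGroupOfForm (galAdicCompletionMap (L := L) (IsCMField.complexConj L) hw) (placeForm (Matrix.of fun i j : Fin 2 => if i.val + j.val + 1 = 2 then (1 : L) else 0) w.1))), (((xm : ↥(unitaryGroupOfForm (galAdicCompletionMap (L := L) (IsCMField.complexConj L) hw) (placeForm (Matrix.of fun i j : Fin 2 => if i.val + j.val + 1 = 2 then (1 : L) else 0) w.1))) : GL (Fin 2) (w.1.adicCompletion L)) : Matrix (Fin 2) (Fin 2) (w.1.adicCompletion L)) = ((((P⁻¹).val * ((t : ((cmDatum L 2 (Matrix.of fun i j : Fin 2 =>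 if i.val + j.val + 1 = 2 then (1 : L) else 0)).Local v × (cmDatum L 1 (Matrix.of fun i j : Fin 1 => if i.val + j.val + 1 = 1 then (1 : L) else 0)).Local v)).1.val.val : Matrix (Fin 2) (Fin 2) (LocalRing L v)) * P.val) 1 1) w) • (1 : Matrix (Fin 2) (Fin 2) (w.1.adicCompletion L)) ∧
      ∀ i b, Odd i → (((x i b : ↥(unitaryGroupOfForm (galAdicCompletionMap (L := L) (IsCMField.complexConj L) hw) (placeForm (Matrix.of fun i j : Fin 2 => if i.val + j.val + 1 = 2 then (1 : L) else 0) w.1))) : GL (Fin 2) (w.1.adicCompletion L)) : Matrix (Fin 2) (Fin 2) (w.1.adicCompletion L)) = ((((P⁻¹).val * ((t : ((cmDatum L 2 (Matrix.of fun i j : Fin 2 => if i.val + j.val + 1 = 2 then (1 : L) else 0)).Local v × (cmDatum L 1 (Matrix.of fun i j : Fin 1 => if i.val + j.val + 1 = 1 then (1 : L) else 0)).Local v)).1.val.val : Matrix (Fin 2) (Fin 2) (LocalRing L v)) * P.val) 1 1) w) • ((1 : Matrix (Fin 2) (Fin 2) (w.1.adicCompletion L)) + (ϖ : (w.1.adicCompletion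 L)) ^ i • !![0, ((η : 𝒪[(w.1.adicCompletion L)]) : (w.1.adicCompletion L)) ^ b; 0, 0]) := fun t => by
    obtain ⟨xm, x, -, -, hxm, -, hx, -⟩ := exists_unitary_signedNormalForm_elements (galAdicCompletionMap (L := L) (IsCMField.complexConj L) hw) (placeForm (Matrix.of fun i j : Fin 2 => if i.val + j.val + 1 = 2 then (1 : L) else 0) w.1) hJ (hcw t) (hcv t) hσϖ hϖO hσηL η.2
    exact ⟨xm, x, hxm, hx⟩
  choose xm xE hxm hxE using hexE
  have hexV : ∀ t : ↥(Subgroup.centralizer ({t₀} : Set ((cmDatum L 2 (Matrix.of fun i j : Fin 2 => if i.val + j.val + 1 = 2 then (1 : L) else 0)).Local v × (cmDatum L 1 (Matrix.of fun i j : Fin 1 => if i.val + j.val + 1 = 1 then (1 : L) else 0)).Local v))), ∃ x : ℕ → ℕ → ↥(unitaryGroupOfForm (galAdicCompletionMap (L := L) (IsCMField.complexConj L) hw) (placeForm (Matrix.of fun i j : Fin 2 => if i.val + j.val + 1 = 2 then (1 : L) else 0) w.1)),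
      ∀ i b, Even i → (((x i b : ↥(unitaryGroupOfForm (galAdicCompletionMap (L := L) (IsCMField.complexConj L) hw) (placeForm (Matrix.of fun i j : Fin 2 => if i.val + j.val + 1 = 2 then (1 : L) else 0) w.1))) : GL (Fin 2) (w.1.adicCompletion L)) : Matrix (Fin 2) (Fin 2) (w.1.adicCompletion L)) = ((((P⁻¹).val * ((t : ((cmDatum L 2 (Matrix.of fun i j : Fin 2 => if i.val + j.val + 1 = 2 then (1 : L) else 0)).Local v × (cmDatum L 1 (Matrix.of fun i j : Fin 1 => if i.val + j.val + 1 = 1 then (1 : L) else 0)).Local v)).1.val.val : Matrix (Fin 2) (Fin 2) (LocalRing L v)) * P.val) 1 1) w) • ((1 : Matrix (Fin 2) (Fin 2) (w.1.adicCompletion L)) + (ϖ : (w.1.adicCompletion L)) ^ i •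
        ((((glDiagonal 2 (w.1.adicCompletion L) ![1, ϖ]) : GL (Fin 2) (w.1.adicCompletion L)) : Matrix (Fin 2) (Fin 2) (w.1.adicCompletion L)) * !![0, ((η : 𝒪[(w.1.adicCompletion L)]) : (w.1.adicCompletion L)) ^ b; 0, 0] * ((((glDiagonal 2 (w.1.adicCompletion L) ![1, ϖ]))⁻¹ : GL (Fin 2) (w.1.adicCompletion L)) : Matrix (Fin 2) (Fin 2) (w.1.adicCompletion L)))) := fun t => by
    obtain ⟨_, x, -, -, -, -, hx, -⟩ := exists_conj_signedNormalForm_elements_modular (galAdicCompletionMap (L := L) (IsCMField.complexConj L) hw) (placeForm (Matrix.of fun i j : Fin 2 => if i.val + j.val + 1 = 2 then (1 : L) else 0) w.1) hJ (glDiagonal 2 (w.1.adicCompletion L) ![1, ϖ]) hD (hcw t) (hcv t) hσϖ hϖO hσηL η.2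
    exact ⟨x, hx⟩
  choose xV hxV using hexV
  obtain ⟨XE, hXE⟩ : ∃ XE : ↥(Subgroup.centralizer ({t₀} : Set ((cmDatum L 2 (Matrix.of fun i j : Fin 2 => if i.val + j.val + 1 = 2 then (1 : L) else 0)).Local v × (cmDatum L 1 (Matrix.of fun i j : Fin 1 => if i.val + j.val + 1 = 1 then (1 : L) else 0)).Local v))) → ℕ → ℕ → ↥(unitaryGroupOfForm (galAdicCompletionMap (L := L) (IsCMField.complexConj L) hw) (placeForm (Matrix.of fun i j : Fin 2 => if i.val + j.val + 1 = 2 then (1 : L) else 0) w.1)), ∀ t i b, XE t i b = if Odd i then xE t i b else xm t := ⟨_, fun _ _ _ => rfl⟩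
  obtain ⟨XV, hXV⟩ : ∃ XV : ↥(Subgroup.centralizer ({t₀} : Set ((cmDatum L 2 (Matrix.of fun i j : Fin 2 => if i.val + j.val + 1 = 2 then (1 : L) else 0)).Local v × (cmDatum L 1 (Matrix.of fun i j : Fin 1 => if i.val + j.val + 1 = 1 then (1 : L) else 0)).Local v))) → ℕ → ℕ → ↥(unitaryGroupOfForm (galAdicCompletionMap (L := L) (IsCMField.complexConj L) hw) (placeForm (Matrix.of fun i j : Fin 2 => if i.val + j.val + 1 = 2 then (1 : L) else 0) w.1)), ∀ t i b, XV t i b = if Even i then xV t i b else xm t := ⟨_, fun _ _ _ => rfl⟩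
  have hXE' : ∀ t i b, Odd i → (((XE t i b : ↥(unitaryGroupOfForm (galAdicCompletionMap (L := L) (IsCMField.complexConj L) hw) (placeForm (Matrix.of fun i j : Fin 2 => if i.val + j.val + 1 = 2 then (1 : L) else 0) w.1))) : GL (Fin 2) (w.1.adicCompletion L)) : Matrix (Fin 2) (Fin 2) (w.1.adicCompletion L)) = ((((P⁻¹).val * ((t : ((cmDatum L 2 (Matrix.of fun i j : Fin 2 => if i.val + j.val + 1 = 2 then (1 : L) else 0)).Local v × (cmDatum L 1 (Matrix.of fun i j : Fin 1 => if i.val + j.val + 1 = 1 then (1 : L) else 0)).Local v)).1.val.val : Matrix (Fin 2) (Fin 2) (LocalRing L v)) * P.val) 1 1) w) • ((1 : Matrix (Fin 2) (Fin 2) (w.1.adicCompletion L)) + (ϖ : (w.1.adicCompletion L)) ^ i • !![0, ((η : 𝒪[(w.1.adicCompletion L)]) : (w.1.adicCompletion L)) ^ b; 0, 0]) :=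
    fun t i b hi => by rw [hXE, if_pos hi]; exact hxE t i b hi
  have hXV' : ∀ t i b, Even i → (((XV t i b : ↥(unitaryGroupOfForm (galAdicCompletionMap (L := L) (IsCMField.complexConj L) hw) (placeForm (Matrix.of fun i j : Fin 2 => if i.val + j.val + 1 = 2 then (1 : L) else 0) w.1))) : GL (Fin 2) (w.1.adicCompletion L)) : Matrix (Fin 2) (Fin 2) (w.1.adicCompletion L)) = ((((P⁻¹).val * ((t : ((cmDatum L 2 (Matrix.of fun i j : Fin 2 => if i.val + j.val + 1 = 2 then (1 : L) else 0)).Local v × (cmDatum L 1 (Matrix.of fun i j : Fin 1 => if i.val + j.val + 1 = 1 then (1 : L) else 0)).Local v)).1.val.val : Matrix (Fin 2) (Fin 2) (LocalRing L v)) * P.val) 1 1) w) • ((1 : Matrix (Fin 2) (Fin 2) (w.1.adicCompletion L)) + (ϖ : (w.1.adicCompletion L)) ^ i •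
      ((((glDiagonal 2 (w.1.adicCompletion L) ![1, ϖ]) : GL (Fin 2) (w.1.adicCompletion L)) : Matrix (Fin 2) (Fin 2) (w.1.adicCompletion L)) * !![0, ((η : 𝒪[(w.1.adicCompletion L)]) : (w.1.adicCompletion L)) ^ b; 0, 0] * ((((glDiagonal 2 (w.1.adicCompletion L) ![1, ϖ]))⁻¹ : GL (Fin 2) (w.1.adicCompletion L)) : Matrix (Fin 2) (Fin 2) (w.1.adicCompletion L)))) :=
    fun t i b hi => by rw [hXV, if_pos hi]; exact hxV t i b hi
  -- §e the frame along `Z(t₀)` at `w` (★ α4 §1), the depth parity, the D-sign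
  have hfr : ∀ t : ↥(Subgroup.centralizer ({t₀} : Set ((cmDatum L 2 (Matrix.of fun i j : Fin 2 => if i.val + j.val + 1 = 2 then (1 : L) else 0)).Local v × (cmDatum L 1 (Matrix.of fun i j : Fin 1 => if i.val + j.val + 1 = 1 then (1 : L) else 0)).Local v))), IsRegularElt ((t : ((cmDatum L 2 (Matrix.of fun i j : Fin 2 => if i.val + j.val + 1 = 2 then (1 : L) else 0)).Local v × (cmDatum L 1 (Matrix.of fun i j : Fin 1 => if i.val + j.val + 1 = 1 then (1 : L) else 0)).Local v)).1.val : GL (Fin 2) (LocalRing L v)) →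
      (∀ i, (galAdicCompletionMap (L := L) (IsCMField.complexConj L) hw) ((![(((P⁻¹).val * ((t : ((cmDatum L 2 (Matrix.of fun i j : Fin 2 => if i.val + j.val + 1 = 2 then (1 : L) else 0)).Local v × (cmDatum L 1 (Matrix.of fun i j : Fin 1 => if i.val + j.val + 1 = 1 then (1 : L) else 0)).Local v)).1.val.val : Matrix (Fin 2) (Fin 2) (LocalRing L v)) * P.val) 0 0) w, (((P⁻¹).val * ((t : ((cmDatum L 2 (Matrix.of fun i j : Fin 2 => if i.val + j.val + 1 = 2 then (1 : L) else 0)).Local v × (cmDatum L 1 (Matrix.of fun i j : Fin 1 => if i.val + j.val + 1 = 1 then (1 : L) else 0)).Local v)).1.val.val : Matrix (Fin 2) (Fin 2) (LocalRing L v)) * P.val) 1 1) w] : Fin 2 → (w.1.adicCompletion L)) i) * (![(((P⁻¹).val * ((t : ((cmDatum L 2 (Matrix.of fun i j : Fin 2 => if i.val + j.val + 1 = 2 then (1 : L) else 0)).Local v × (cmDatum L 1 (Matrix.of fun i j : Fin 1 => if i.val + j.val + 1 = 1 then (1 : L) else 0)).Local v)).1.val.val : Matrix (Fin 2) (Fin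 2) (LocalRing L v)) * P.val) 0 0) w, (((P⁻¹).val * ((t : ((cmDatum L 2 (Matrix.of fun i j : Fin 2 => if i.val + j.val + 1 = 2 then (1 : L) else 0)).Local v × (cmDatum L 1 (Matrix.of fun i j : Fin 1 => if i.val + j.val + 1 = 1 then (1 : L) else 0)).Local v)).1.val.val : Matrix (Fin 2) (Fin 2) (LocalRing L v)) * P.val) 1 1) w] : Fin 2 → (w.1.adicCompletion L)) i = 1) ∧
        Valued.v ((![(((P⁻¹).val * ((t : ((cmDatum L 2 (Matrix.of fun i j : Fin 2 => if i.val + j.val + 1 = 2 then (1 : L) else 0)).Local v × (cmDatum L 1 (Matrix.of fun i j : Fin 1 => if i.val + j.val + 1 = 1 then (1 : L) else 0)).Local v)).1.val.val : Matrix (Fin 2) (Fin 2) (LocalRing L v)) * P.val) 0 0) w, (((P⁻¹).val * ((t : ((cmDatum L 2 (Matrix.of fun i j : Fin 2 => if i.val + j.val + 1 = 2 then (1 : L) else 0)).Local v × (cmDatum L 1 (Matrix.of fun i j : Fin 1 => if i.val + j.val + 1 = 1 then (1 : L) else 0)).Local v)).1.val.val : Matrix (Fin 2) (Fin 2) (LocalRing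 L v)) * P.val) 1 1) w] : Fin 2 → (w.1.adicCompletion L)) 0 - (![(((P⁻¹).val * ((t : ((cmDatum L 2 (Matrix.of fun i j : Fin 2 => if i.val + j.val + 1 = 2 then (1 : L) else 0)).Local v × (cmDatum L 1 (Matrix.of fun i j : Fin 1 => if i.val + j.val + 1 = 1 then (1 : L) else 0)).Local v)).1.val.val : Matrix (Fin 2) (Fin 2) (LocalRing L v)) * P.val) 0 0) w, (((P⁻¹).val * ((t : ((cmDatum L 2 (Matrix.of fun i j : Fin 2 => if i.val + j.val + 1 = 2 then (1 : L) else 0)).Local v × (cmDatum L 1 (Matrix.of fun i j : Fin 1 => if i.val + j.val + 1 = 1 then (1 : L) else 0)).Local v)).1.val.val : Matrix (Fin 2) (Fin 2) (LocalRing L v)) * P.val) 1 1) w] : Fin 2 → (w.1.adicCompletion L)) 1) = Valued.v (ϖ : (w.1.adicCompletion L)) ^ (-WithZero.log (Valued.v ((((P⁻¹).val * ((t : ((cmDatum L 2 (Matrix.of fun i j : Fin 2 => if i.val + j.val + 1 = 2 then (1 : L) else 0)).Local v × (cmDatum L 1 (Matrix.of fun i j : Fin 1 => if i.val + j.val + 1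 = 1 then (1 : L) else 0)).Local v)).1.val.val : Matrix (Fin 2) (Fin 2) (LocalRing L v)) * P.val) 0 0 - ((P⁻¹).val * ((t : ((cmDatum L 2 (Matrix.of fun i j : Fin 2 => if i.val + j.val + 1 = 2 then (1 : L) else 0)).Local v × (cmDatum L 1 (Matrix.of fun i j : Fin 1 => if i.val + j.val + 1 = 1 then (1 : L) else 0)).Local v)).1.val.val : Matrix (Fin 2) (Fin 2) (LocalRing L v)) * P.val) 1 1) w))).toNat := fun t hreg => by
    obtain ⟨-, -, hu1, hn⟩ := frame_onePlace_of_mem_centralizer_of_v_eq L v w hw t₀ P d ht₀ hP hd1 (ϖ : (w.1.adicCompletion L)) hϖ E₂ hE₂ t hreg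
    exact ⟨hu1, hn⟩
  have hNodd : ∀ t : ↥(Subgroup.centralizer ({t₀} : Set ((cmDatum L 2 (Matrix.of fun i j : Fin 2 => if i.val + j.val + 1 = 2 then (1 : L) else 0)).Local v × (cmDatum L 1 (Matrix.of fun i j : Fin 1 => if i.val + j.val + 1 = 1 then (1 : L) else 0)).Local v))), IsRegularElt ((t : ((cmDatum L 2 (Matrix.of fun i j : Fin 2 => if i.val + j.val + 1 = 2 then (1 : L) else 0)).Local v × (cmDatum L 1 (Matrix.of fun i j : Fin 1 => if i.val + j.val + 1 = 1 then (1 : L) else 0)).Local v)).1.val : GL (Fin 2) (LocalRing L v)) → m₀ + 1 ≤ (-WithZero.log (Valued.v ((((P⁻¹).val * ((t : ((cmDatum L 2 (Matrix.of fun i j : Fin 2 => if i.val + j.val + 1 = 2 then (1 : L) else 0)).Local v × (cmDatum L 1 (Matrix.of fun i j : Fin 1 => if i.val + j.val + 1 = 1 then (1 : L) else 0)).Local v)).1.val.val : Matrix (Fin 2) (Fin 2) (LocalRing L v)) * P.val) 0 0 - ((P⁻¹).val * ((t : ((cmDatum L 2 (Matrix.of fun i j : Fin 2 => if i.val + j.val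 + 1 = 2 then (1 : L) else 0)).Local v × (cmDatum L 1 (Matrix.of fun i j : Fin 1 => if i.val + j.val + 1 = 1 then (1 : L) else 0)).Local v)).1.val.val : Matrix (Fin 2) (Fin 2) (LocalRing L v)) * P.val) 1 1) w))).toNat → (-WithZero.log (Valued.v ((((P⁻¹).val * ((t : ((cmDatum L 2 (Matrix.of fun i j : Fin 2 => if i.val + j.val + 1 = 2 then (1 : L) else 0)).Local v × (cmDatum L 1 (Matrix.of fun i j : Fin 1 => if i.val + j.val + 1 = 1 then (1 : L) else 0)).Local v)).1.val.val : Matrix (Fin 2) (Fin 2) (LocalRing L v)) * P.val) 0 0 - ((P⁻¹).val * ((t : ((cmDatum L 2 (Matrix.of fun i j : Fin 2 => if i.val + j.val + 1 = 2 then (1 : L) else 0)).Local v × (cmDatum L 1 (Matrix.of fun i j : Fin 1 => if i.val + j.val + 1 = 1 then (1 : L) else 0)).Local v)).1.val.val : Matrix (Fin 2) (Fin 2) (LocalRing L v)) * P.val) 1 1) w))).toNat % 2 = 1 := fun t hreg hmN => by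
    obtain ⟨hu1, hn⟩ := hfr t hreg
    have hval : ∀ i, valuation (w.1.adicCompletion L) ((![(((P⁻¹).val * ((t : ((cmDatum L 2 (Matrix.of fun i j : Fin 2 => if i.val + j.val + 1 = 2 then (1 : L) else 0)).Local v × (cmDatum L 1 (Matrix.of fun i j : Fin 1 => if i.val + j.val + 1 = 1 then (1 : L) else 0)).Local v)).1.val.val : Matrix (Fin 2) (Fin 2) (LocalRing L v)) * P.val) 0 0) w, (((P⁻¹).val * ((t : ((cmDatum L 2 (Matrix.of fun i j : Fin 2 => if i.val + j.val + 1 = 2 then (1 : L) else 0)).Local v × (cmDatum L 1 (Matrix.of fun i j : Fin 1 => if i.val + j.val + 1 = 1 then (1 : L) else 0)).Local v)).1.val.val : Matrix (Fin 2) (Fin 2) (LocalRing L v)) * P.val) 1 1) w] : Fin 2 → (w.1.adicCompletion L)) i) = 1 := fun i =>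
      valuation_eq_one_of_galAdicCompletionMap_mul_self L v w hw (hu1 i)
    have hN' : valuation (w.1.adicCompletion L) ((![(((P⁻¹).val * ((t : ((cmDatum L 2 (Matrix.of fun i j : Fin 2 => if i.val + j.val + 1 = 2 then (1 : L) else 0)).Local v × (cmDatum L 1 (Matrix.of fun i j : Fin 1 => if i.val + j.val + 1 = 1 then (1 : L) else 0)).Local v)).1.val.val : Matrix (Fin 2) (Fin 2) (LocalRing L v)) * P.val) 0 0) w, (((P⁻¹).val * ((t : ((cmDatum L 2 (Matrix.of fun i j : Fin 2 => if i.val + j.val + 1 = 2 then (1 : L) else 0)).Local v × (cmDatum L 1 (Matrix.of fun i j : Fin 1 => if i.val + j.val + 1 = 1 then (1 : L) else 0)).Local v)).1.val.val : Matrix (Fin 2) (Fin 2) (LocalRing L v)) * P.val) 1 1) w] : Fin 2 → (w.1.adicCompletion L)) 0 - (![(((P⁻¹).val * ((t : ((cmDatum L 2 (Matrix.of fun i j : Fin 2 => if i.val + j.val + 1 = 2 then (1 : L) else 0)).Local v × (cmDatum L 1 (Matrix.of fun i j : Fin 1 => if i.val + j.val + 1 = 1 then (1 : L) else 0)).Local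 v)).1.val.val : Matrix (Fin 2) (Fin 2) (LocalRing L v)) * P.val) 0 0) w, (((P⁻¹).val * ((t : ((cmDatum L 2 (Matrix.of fun i j : Fin 2 => if i.val + j.val + 1 = 2 then (1 : L) else 0)).Local v × (cmDatum L 1 (Matrix.of fun i j : Fin 1 => if i.val + j.val + 1 = 1 then (1 : L) else 0)).Local v)).1.val.val : Matrix (Fin 2) (Fin 2) (LocalRing L v)) * P.val) 1 1) w] : Fin 2 → (w.1.adicCompletion L)) 1) = valuation (w.1.adicCompletion L) ((ϖ : (w.1.adicCompletion L)) ^ (-WithZero.log (Valued.v ((((P⁻¹).val * ((t : ((cmDatum L 2 (Matrix.of fun i j : Fin 2 => if i.val + j.val + 1 = 2 then (1 : L) else 0)).Local v × (cmDatum L 1 (Matrix.of fun i j : Fin 1 => if i.val + j.val + 1 = 1 then (1 : L) else 0)).Local v)).1.val.val : Matrix (Fin 2) (Fin 2) (LocalRing L v)) * P.val) 0 0 - ((P⁻¹).val * ((t : ((cmDatum L 2 (Matrix.of fun i j : Fin 2 => if i.val + j.val + 1 = 2 then (1 : L) else 0)).Local v × (cmDatum L 1 (Matrix.of fun i j : Fin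 1 => if i.val + j.val + 1 = 1 then (1 : L) else 0)).Local v)).1.val.val : Matrix (Fin 2) (Fin 2) (LocalRing L v)) * P.val) 1 1) w))).toNat) := by
      rw [← v_eq_iff_valuation_eq, hn, map_pow]
    exact Nat.odd_iff.1 (odd_of_valuation_sub_eq_of_norm_one (galAdicCompletionMap (L := L) (IsCMField.complexConj L) hw) hϖ' hσϖ σO hσO' h2O hres (hu1 0) (hu1 1) (hval 0) (hval 1) hN' (by omega))
  have hkey : ∀ (x : (w.1.adicCompletion L)) (N : ℕ), Valued.v x = Valued.v (ϖ : (w.1.adicCompletion L)) ^ N → Valued.v (x * ((ϖ : (w.1.adicCompletion L)) ^ N)⁻¹) = 1 := fun x N hx => by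
    rw [map_mul, map_inv₀, map_pow, hx, mul_inv_cancel₀ (pow_ne_zero _ ((Valuation.ne_zero_iff _).2 hϖ0))]
  have hU : ∀ t : ↥(Subgroup.centralizer ({t₀} : Set ((cmDatum L 2 (Matrix.of fun i j : Fin 2 => if i.val + j.val + 1 = 2 then (1 : L) else 0)).Local v × (cmDatum L 1 (Matrix.of fun i j : Fin 1 => if i.val + j.val + 1 = 1 then (1 : L) else 0)).Local v))), IsRegularElt ((t : ((cmDatum L 2 (Matrix.of fun i j : Fin 2 => if i.val + j.val + 1 = 2 then (1 : L) else 0)).Local v × (cmDatum L 1 (Matrix.of fun i j : Fin 1 => if i.val + j.val + 1 = 1 then (1 : L) else 0)).Local v)).1.val : GL (Fin 2) (LocalRing L v)) → Valued.v ((((P⁻¹).val * ((t : ((cmDatum L 2 (Matrix.of fun i j : Fin 2 => if i.val + j.val + 1 = 2 then (1 : L) else 0)).Local v × (cmDatum L 1 (Matrix.of fun i j : Fin 1 => if i.val + j.val + 1 = 1 then (1 : L) else 0)).Local v)).1.val.val : Matrix (Fin 2) (Fin 2) (LocalRing L v)) * P.val) 0 0 - ((P⁻¹).val * ((t : ((cmDatum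 L 2 (Matrix.of fun i j : Fin 2 => if i.val + j.val + 1 = 2 then (1 : L) else 0)).Local v × (cmDatum L 1 (Matrix.of fun i j : Fin 1 => if i.val + j.val + 1 = 1 then (1 : L) else 0)).Local v)).1.val.val : Matrix (Fin 2) (Fin 2) (LocalRing L v)) * P.val) 1 1) w * ((ϖ : (w.1.adicCompletion L)) ^ (-WithZero.log (Valued.v ((((P⁻¹).val * ((t : ((cmDatum L 2 (Matrix.of fun i j : Fin 2 => if i.val + j.val + 1 = 2 then (1 : L) else 0)).Local v × (cmDatum L 1 (Matrix.of fun i j : Fin 1 => if i.val + j.val + 1 = 1 then (1 : L) else 0)).Local v)).1.val.val : Matrix (Fin 2) (Fin 2) (LocalRing L v)) * P.val) 0 0 - ((P⁻¹).val * ((t : ((cmDatum L 2 (Matrix.of fun i j : Fin 2 => if i.val + j.val + 1 = 2 then (1 : L) else 0)).Local v × (cmDatum L 1 (Matrix.of fun i j : Fin 1 => if i.val + j.val + 1 = 1 then (1 : L) else 0)).Local v)).1.val.val : Matrix (Fin 2) (Fin 2) (LocalRing L v)) * P.val) 1 1) w))).toNat)⁻¹) = 1 := fun t hreg => by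
    obtain ⟨-, hn⟩ := hfr t hreg
    refine hkey _ _ ?_
    simpa only [Matrix.cons_val_zero, Matrix.cons_val_one, Matrix.cons_val_fin_one, Pi.sub_apply] using hn
  have hcV : ∀ t : ↥(Subgroup.centralizer ({t₀} : Set ((cmDatum L 2 (Matrix.of fun i j : Fin 2 => if i.val + j.val + 1 = 2 then (1 : L) else 0)).Local v × (cmDatum L 1 (Matrix.of fun i j : Fin 1 => if i.val + j.val + 1 = 1 then (1 : L) else 0)).Local v))), Valued.v ((((P⁻¹).val * ((t : ((cmDatum L 2 (Matrix.of fun i j : Fin 2 => if i.val + j.val + 1 = 2 then (1 : L) else 0)).Local v × (cmDatum L 1 (Matrix.of fun i j : Fin 1 => if i.val + j.val + 1 = 1 then (1 : L) else 0)).Local v)).1.val.val : Matrix (Fin 2) (Fin 2) (LocalRing L v)) * P.val) 1 1) w) = 1 := fun t => (v_eq_one_iff_valuation_eq_one _).2 (hcv t)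
  obtain ⟨εD, hεD⟩ : ∃ εD : ↥(Subgroup.centralizer ({t₀} : Set ((cmDatum L 2 (Matrix.of fun i j : Fin 2 => if i.val + j.val + 1 = 2 then (1 : L) else 0)).Local v × (cmDatum L 1 (Matrix.of fun i j : Fin 1 => if i.val + j.val + 1 = 1 then (1 : L) else 0)).Local v))) → ℂ, ∀ t, εD t = if hO : ((((P⁻¹).val * ((t : ((cmDatum L 2 (Matrix.of fun i j : Fin 2 => if i.val + j.val + 1 = 2 then (1 : L) else 0)).Local v × (cmDatum L 1 (Matrix.of fun i j : Fin 1 => if i.val + j.val + 1 = 1 then (1 : L) else 0)).Local v)).1.val.val : Matrix (Fin 2) (Fin 2) (LocalRing L v)) * P.val) 1 1) w * ((((P⁻¹).val * ((t : ((cmDatum L 2 (Matrix.of fun i j : Fin 2 => if i.val + j.val + 1 = 2 then (1 : L) else 0)).Local v × (cmDatum L 1 (Matrix.of fun i j : Fin 1 => if i.val + j.val + 1 = 1 then (1 : L) else 0)).Local v)).1.val.val : Matrix (Fin 2) (Fin 2) (LocalRing L v)) * P.val) 0 0 - ((P⁻¹).val * ((t : ((cmDatum L 2 (Matrix.of fun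 i j : Fin 2 => if i.val + j.val + 1 = 2 then (1 : L) else 0)).Local v × (cmDatum L 1 (Matrix.of fun i j : Fin 1 => if i.val + j.val + 1 = 1 then (1 : L) else 0)).Local v)).1.val.val : Matrix (Fin 2) (Fin 2) (LocalRing L v)) * P.val) 1 1) w * ((ϖ : (w.1.adicCompletion L)) ^ (-WithZero.log (Valued.v ((((P⁻¹).val * ((t : ((cmDatum L 2 (Matrix.of fun i j : Fin 2 => if i.val + j.val + 1 = 2 then (1 : L) else 0)).Local v × (cmDatum L 1 (Matrix.of fun i j : Fin 1 => if i.val + j.val + 1 = 1 then (1 : L) else 0)).Local v)).1.val.val : Matrix (Fin 2) (Fin 2) (LocalRing L v)) * P.val) 0 0 - ((P⁻¹).val * ((t : ((cmDatum L 2 (Matrix.of fun i j : Fin 2 => if i.val + j.val + 1 = 2 then (1 : L) else 0)).Local v × (cmDatum L 1 (Matrix.of fun i j : Fin 1 => if i.val + j.val + 1 = 1 then (1 : L) else 0)).Local v)).1.val.val : Matrix (Fin 2) (Fin 2) (LocalRing L v)) * P.val) 1 1) w))).toNat)⁻¹) * h 0) ∈ 𝒪[(w.1.adicCompletion L)] 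then
      (if IsSquare (IsLocalRing.residue 𝒪[(w.1.adicCompletion L)] ⟨_, hO⟩) then (1 : ℂ) else -1) else 1 := ⟨_, fun _ => rfl⟩
  have hεDspec : ∀ t : ↥(Subgroup.centralizer ({t₀} : Set ((cmDatum L 2 (Matrix.of fun i j : Fin 2 => if i.val + j.val + 1 = 2 then (1 : L) else 0)).Local v × (cmDatum L 1 (Matrix.of fun i j : Fin 1 => if i.val + j.val + 1 = 1 then (1 : L) else 0)).Local v))), IsRegularElt ((t : ((cmDatum L 2 (Matrix.of fun i j : Fin 2 => if i.val + j.val + 1 = 2 then (1 : L) else 0)).Local v × (cmDatum L 1 (Matrix.of fun i j : Fin 1 => if i.val + j.val + 1 = 1 then (1 : L) else 0)).Local v)).1.val : GL (Fin 2) (LocalRing L v)) → ∀ S : 𝒪[(w.1.adicCompletion L)],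
      (S : (w.1.adicCompletion L)) = (((P⁻¹).val * ((t : ((cmDatum L 2 (Matrix.of fun i j : Fin 2 => if i.val + j.val + 1 = 2 then (1 : L) else 0)).Local v × (cmDatum L 1 (Matrix.of fun i j : Fin 1 => if i.val + j.val + 1 = 1 then (1 : L) else 0)).Local v)).1.val.val : Matrix (Fin 2) (Fin 2) (LocalRing L v)) * P.val) 1 1) w * ((((P⁻¹).val * ((t : ((cmDatum L 2 (Matrix.of fun i j : Fin 2 => if i.val + j.val + 1 = 2 then (1 : L) else 0)).Local v × (cmDatum L 1 (Matrix.of fun i j : Fin 1 => if i.val + j.val + 1 = 1 then (1 : L) else 0)).Local v)).1.val.val : Matrix (Fin 2) (Fin 2) (LocalRing L v)) * P.val) 0 0 - ((P⁻¹).val * ((t : ((cmDatum L 2 (Matrix.of fun i j : Fin 2 => if i.val + j.val + 1 = 2 then (1 : L) else 0)).Local v × (cmDatum L 1 (Matrix.of fun i j : Fin 1 => if i.val + j.val + 1 = 1 then (1 : L) else 0)).Local v)).1.val.val : Matrix (Fin 2) (Fin 2) (LocalRing L v)) * P.val) 1 1) w * ((ϖ : (w.1.adicCompletion L)) ^ (-WithZero.log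 (Valued.v ((((P⁻¹).val * ((t : ((cmDatum L 2 (Matrix.of fun i j : Fin 2 => if i.val + j.val + 1 = 2 then (1 : L) else 0)).Local v × (cmDatum L 1 (Matrix.of fun i j : Fin 1 => if i.val + j.val + 1 = 1 then (1 : L) else 0)).Local v)).1.val.val : Matrix (Fin 2) (Fin 2) (LocalRing L v)) * P.val) 0 0 - ((P⁻¹).val * ((t : ((cmDatum L 2 (Matrix.of fun i j : Fin 2 => if i.val + j.val + 1 = 2 then (1 : L) else 0)).Local v × (cmDatum L 1 (Matrix.of fun i j : Fin 1 => if i.val + j.val + 1 = 1 then (1 : L) else 0)).Local v)).1.val.val : Matrix (Fin 2) (Fin 2) (LocalRing L v)) * P.val) 1 1) w))).toNat)⁻¹) * h 0 → εD t = if IsSquare (IsLocalRing.residue 𝒪[(w.1.adicCompletion L)] S) then (1 : ℂ) else -1 := by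
    intro t _ S hS
    have hO : ((((P⁻¹).val * ((t : ((cmDatum L 2 (Matrix.of fun i j : Fin 2 => if i.val + j.val + 1 = 2 then (1 : L) else 0)).Local v × (cmDatum L 1 (Matrix.of fun i j : Fin 1 => if i.val + j.val + 1 = 1 then (1 : L) else 0)).Local v)).1.val.val : Matrix (Fin 2) (Fin 2) (LocalRing L v)) * P.val) 1 1) w * ((((P⁻¹).val * ((t : ((cmDatum L 2 (Matrix.of fun i j : Fin 2 => if i.val + j.val + 1 = 2 then (1 : L) else 0)).Local v × (cmDatum L 1 (Matrix.of fun i j : Fin 1 => if i.val + j.val + 1 = 1 then (1 : L) else 0)).Local v)).1.val.val : Matrix (Fin 2) (Fin 2) (LocalRing L v)) * P.val) 0 0 - ((P⁻¹).val * ((t : ((cmDatum L 2 (Matrix.of fun i j : Fin 2 => if i.val + j.val + 1 = 2 then (1 : L) else 0)).Local v × (cmDatum L 1 (Matrix.of fun i j : Fin 1 => if i.val + j.val + 1 = 1 then (1 : L) else 0)).Local v)).1.val.val : Matrix (Fin 2) (Fin 2) (LocalRing L v)) * P.val) 1 1) w * ((ϖ : (w.1.adicCompletion L)) ^ (-WithZero.log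 (Valued.v ((((P⁻¹).val * ((t : ((cmDatum L 2 (Matrix.of fun i j : Fin 2 => if i.val + j.val + 1 = 2 then (1 : L) else 0)).Local v × (cmDatum L 1 (Matrix.of fun i j : Fin 1 => if i.val + j.val + 1 = 1 then (1 : L) else 0)).Local v)).1.val.val : Matrix (Fin 2) (Fin 2) (LocalRing L v)) * P.val) 0 0 - ((P⁻¹).val * ((t : ((cmDatum L 2 (Matrix.of fun i j : Fin 2 => if i.val + j.val + 1 = 2 then (1 : L) else 0)).Local v × (cmDatum L 1 (Matrix.of fun i j : Fin 1 => if i.val + j.val + 1 = 1 then (1 : L) else 0)).Local v)).1.val.val : Matrix (Fin 2) (Fin 2) (LocalRing L v)) * P.val) 1 1) w))).toNat)⁻¹) * h 0) ∈ 𝒪[(w.1.adicCompletion L)] := hS ▸ S.2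
    rw [hεD, dif_pos hO, show (⟨_, hO⟩ : 𝒪[(w.1.adicCompletion L)]) = S from Subtype.ext hS.symm]
  -- §f the bookkeeping functions of the piece index
  obtain ⟨par, hpar⟩ : ∃ par : Fin n → ℕ, ∀ k, par k = if ε k = 0 then 0 else 1 := ⟨_, fun _ => rfl⟩
  obtain ⟨σ, hσ⟩ : ∃ σ : Fin n → ℂ, ∀ k, σ k = if ε k = 0 then (if IsSquare (IsLocalRing.residue 𝒪[(w.1.adicCompletion L)] (-1)) then (1 : ℂ) else -1) else 1 := ⟨_, fun _ => rfl⟩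
  obtain ⟨r', hr'⟩ : ∃ r' : Fin n → ℝ, ∀ k, r' k = ν.real (((K₂ (ε k)).prod (⊤ : Subgroup ((cmDatum L 1 (Matrix.of fun i j : Fin 1 => if i.val + j.val + 1 = 1 then (1 : L) else 0)).Local v)) : Subgroup ((cmDatum L 2 (Matrix.of fun i j : Fin 2 => if i.val + j.val + 1 = 2 then (1 : L) else 0)).Local v × (cmDatum L 1 (Matrix.of fun i j : Fin 1 => if i.val + j.val + 1 = 1 then (1 : L) else 0)).Local v)) : Set ((cmDatum L 2 (Matrix.of fun i j : Fin 2 => if i.val + j.val + 1 = 2 then (1 : L) else 0)).Local v × (cmDatum L 1 (Matrix.of fun i j : Fin 1 => if i.val + j.val + 1 = 1 then (1 : L) else 0)).Local v)) := ⟨_, fun _ => rfl⟩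
  obtain ⟨A, hA⟩ : ∃ A : Fin n → ℕ → ℕ, ∀ k N, A k N = if ε k = 0 then (∑ j ∈ (Finset.range (N + 1)).filter (fun j => j % 2 = 0 ∧ j + (m₀ + 1) ≤ N), (if j = 0 then 1 else 2 * (Nat.card (𝓞 ↥(maximalRealSubfield L) ⧸ v.asIdeal)) ^ (j / 2))) else (∑ j ∈ (Finset.range (N + 1)).filter (fun j => j % 2 = 1 ∧ j + (m₀ + 1) ≤ N), (if j = 0 then 1 else 2 * (Nat.card (𝓞 ↥(maximalRealSubfield L) ⧸ v.asIdeal)) ^ (j / 2))) := ⟨_, fun _ _ => rfl⟩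
  obtain ⟨c, hc⟩ : ∃ c : Fin n → ℕ → ℕ → ℕ, ∀ k N i, c k N i = if (N - i) % 2 = par k then 2 * (Nat.card (𝓞 ↥(maximalRealSubfield L) ⧸ v.asIdeal)) ^ ((N - i) / 2) else 0 := ⟨_, fun _ _ _ => rfl⟩
  obtain ⟨M, hM⟩ : ∃ M : Fin n → ℕ → ℕ → Matrix (Fin 2) (Fin 2) (w.1.adicCompletion L), ∀ k i b, M k i b =
      if ε k = 0 then (if Odd i then ((1 : Matrix (Fin 2) (Fin 2) (w.1.adicCompletion L)) + (ϖ : (w.1.adicCompletion L)) ^ i • !![0, ((η : 𝒪[(w.1.adicCompletion L)]) : (w.1.adicCompletion L)) ^ b; 0, 0]) else 1)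
      else (if Even i then ((1 : Matrix (Fin 2) (Fin 2) (w.1.adicCompletion L)) + (ϖ : (w.1.adicCompletion L)) ^ i •
        ((((glDiagonal 2 (w.1.adicCompletion L) ![1, ϖ]) : GL (Fin 2) (w.1.adicCompletion L)) : Matrix (Fin 2) (Fin 2) (w.1.adicCompletion L)) * !![0, ((η : 𝒪[(w.1.adicCompletion L)]) : (w.1.adicCompletion L)) ^ b; 0, 0] * ((((glDiagonal 2 (w.1.adicCompletion L) ![1, ϖ]))⁻¹ : GL (Fin 2) (w.1.adicCompletion L)) : Matrix (Fin 2) (Fin 2) (w.1.adicCompletion L)))) else 1) :=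
    ⟨_, fun _ _ _ => rfl⟩
  obtain ⟨X, hX⟩ : ∃ X : Fin n → ↥(Subgroup.centralizer ({t₀} : Set ((cmDatum L 2 (Matrix.of fun i j : Fin 2 => if i.val + j.val + 1 = 2 then (1 : L) else 0)).Local v × (cmDatum L 1 (Matrix.of fun i j : Fin 1 => if i.val + j.val + 1 = 1 then (1 : L) else 0)).Local v))) → ℕ → ℕ → ↥(unitaryGroupOfForm (galAdicCompletionMap (L := L) (IsCMField.complexConj L) hw) (placeForm (Matrix.of fun i j : Fin 2 => if i.val + j.val + 1 = 2 then (1 : L) else 0) w.1)), ∀ k t i b, X k t i b = if ε k = 0 then XE t i b else XV t i b := ⟨_, fun _ _ _ _ => rfl⟩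
  refine ⟨n, φk, m₀ + 1, xm, M, X, par, σ, r', A, c, εD, fun k => (hφk k).1, fun t hreg => hsum e (t : ((cmDatum L 2 (Matrix.of fun i j : Fin 2 => if i.val + j.val + 1 = 2 then (1 : L) else 0)).Local v × (cmDatum L 1 (Matrix.of fun i j : Fin 1 => if i.val + j.val + 1 = 1 then (1 : L) else 0)).Local v)) t.2 hreg (hest t hreg), hS3, ?_, ?_, ?_, hNodd, hεDspec, ?_⟩
  · -- `hX`
    intro k t i b
    rw [hX, hM]
    rcases hε k with h0 | h1
    · rw [if_pos h0, if_pos h0, hXE]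
      by_cases hi : Odd i
      · rw [if_pos hi, if_pos hi]; exact hxE t i b hi
      · rw [if_neg hi, if_neg hi]; exact hxm t
    · have hk0 : ¬ ε k = 0 := by rw [h1]; exact one_ne_zero
      rw [if_neg hk0, if_neg hk0, hXV]
      by_cases hi : Even i
      · rw [if_pos hi, if_pos hi]; exact hxV t i b hi
      · rw [if_neg hi, if_neg hi]; exact hxm t
  · intro k N i _ hp; rw [hc, if_pos hp]
  · intro k N i _ hp; rw [hc, if_neg hp]
  · -- `hpair`: the PAIR per piece type, weights on the window, the bits' sign law through the seam
    intro k t hreg hmN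
    have hNo := hNodd t hreg hmN
    rcases hε k with h0 | h1
    · -- EDGE piece `K⁰`
      obtain ⟨b, hb1, hbit, hO, hO'⟩ := depthExpansion_pair_ramified_selfDual L v w hw ν t₀ P d ht₀ hP hd1 he h2 ϖ hϖ hσϖ σO hσO' hσσ hres u hvu hσu hηu' hηu hση hη
        E₂ hE₂ e he2 hconj (K₂ 0) hdict0 (hK₂o 0) (hK₂c 0) (φk k) (by simpa only [h0] using hφkK k) (by simpa only [h0] using hφkinv k)
        Q hQ hQh hh hσh r hr hsq (m₀ + 1) (by omega) ((localCongruenceSubgroup 2 L w.1 m₀).subgroupOf (unitaryGroupOfForm (galAdicCompletionMap (L := L) (IsCMField.complexConj L) hw) (placeForm (Matrix.of fun i j : Fin 2 => if i.val + j.val + 1 = 2 then (1 : L) else 0) w.1))) hKmE (fun a x' y hy => hφm₀ k a x' y hy)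
        xm hxm XE hXE' t hreg hmN
      refine ⟨b, hb1, fun i hi hp => ?_, ?_, ?_⟩
      · rw [hpar, if_pos h0] at hp
        rw [hσ, if_pos h0]
        have him := Finset.mem_range.1 hi
        have hio : Odd i := Nat.odd_iff.2 (by omega)
        have hNi : ((-WithZero.log (Valued.v ((((P⁻¹).val * ((t : ((cmDatum L 2 (Matrix.of fun i j : Fin 2 => if i.val + j.val + 1 = 2 then (1 : L) else 0)).Local v × (cmDatum L 1 (Matrix.of fun i j : Fin 1 => if i.val + j.val + 1 = 1 then (1 : L) else 0)).Local v)).1.val.val : Matrix (Fin 2) (Fin 2) (LocalRing L v)) * P.val) 0 0 - ((P⁻¹).val * ((t : ((cmDatum L 2 (Matrix.of fun i j : Fin 2 => if i.val + j.val + 1 = 2 then (1 : L) else 0)).Local v × (cmDatum L 1 (Matrix.of fun i j : Fin 1 => if i.val + j.val + 1 = 1 then (1 : L) else 0)).Local v)).1.val.val : Matrix (Fin 2) (Fin 2) (LocalRing L v)) * P.val) 1 1) w))).toNat + i) % 2 = 0 := by omega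
        exact neg_one_pow_bit_eq_edge w.1 (hcV t) (hU t hreg) (hh 0) rfl (hεDspec t hreg) hNi (hb1 i) (hbit i him hio)
      · simp only [hr', hA, hc, hX, hpar, if_pos h0]
        rw [h0, hO]
        congr 2
        exact Finset.sum_congr rfl fun i hi => by rw [windowWeight_eq_ite (Nat.card (𝓞 ↥(maximalRealSubfield L) ⧸ v.asIdeal)) 0 (Finset.mem_range.1 hi) hmN]
      · simp only [hr', hA, hc, hX, hpar, if_pos h0]
        rw [h0, hO']
        congr 2
        exact Finset.sum_congr rfl fun i hi => by rw [windowWeight_eq_ite (Nat.card (𝓞 ↥(maximalRealSubfield L) ⧸ v.asIdeal)) 0 (Finset.mem_range.1 hi) hmN]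
    · -- VERTEX piece `K♯`
      have hk0 : ¬ ε k = 0 := by rw [h1]; exact one_ne_zero
      obtain ⟨b, hb1, hbit, hO, hO'⟩ := depthExpansion_pair_ramified_modular L v w hw ν t₀ P d ht₀ hP hd1 he h2 ϖ hϖ hσϖ σO hσO' hσσ hres u hvu hσu hηu' hηu hση hη
        (glDiagonal 2 (w.1.adicCompletion L) ![1, ϖ]) hD E₂ hE₂ e he2 hconj (K₂ 1) hdict1 (hK₂o 1) (hK₂c 1) (φk k) (by simpa only [h1] using hφkK k) (by simpa only [h1] using hφkinv k)
        Q hQ hQh hh hσh r hr hsq (m₀ + 1) (by omega) ((localCongruenceSubgroup 2 L w.1 m₀).subgroupOf (unitaryGroupOfForm (galAdicCompletionMap (L := L) (IsCMField.complexConj L) hw) (placeForm (Matrix.of fun i j : Fin 2 => if i.val + j.val + 1 = 2 then (1 : L) else 0) w.1))) hKmV (fun a x' y hy => hφm₀ k a x' y hy)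
        xm hxm XV hXV' t hreg hmN
      refine ⟨b, hb1, fun i hi hp => ?_, ?_, ?_⟩
      · rw [hpar, if_neg hk0] at hp
        rw [hσ, if_neg hk0]
        have him := Finset.mem_range.1 hi
        have hie : Even i := Nat.even_iff.2 (by omega)
        exact neg_one_pow_bit_eq_vertex w.1 (hcV t) (hU t hreg) (hh 0) rfl (hεDspec t hreg) (hb1 i) (hbit i him hie)
      · simp only [hr', hA, hc, hX, hpar, if_neg hk0]
        rw [h1, hO]
        congr 2
        exact Finset.sum_congr rfl fun i hi => by rw [windowWeight_eq_ite (Nat.card (𝓞 ↥(maximalRealSubfield L) ⧸ v.asIdeal)) 1 (Finset.mem_range.1 hi) hmN]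
      · simp only [hr', hA, hc, hX, hpar, if_neg hk0]
        rw [h1, hO']
        congr 2
        exact Finset.sum_congr rfl fun i hi => by rw [windowWeight_eq_ite (Nat.card (𝓞 ↥(maximalRealSubfield L) ⧸ v.asIdeal)) 1 (Finset.mem_range.1 hi) hmN]

end Glue

end Literature.NumberTheory.Rogawski1990

end
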